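import Literature.NumberTheory.LFunctions.ConnesProlateGuessTurning
import HarnessLib

/-!
# Sturm–Picone comparison for prolate functions and eigenvalue pinning

THIS IS NOT AN RH STATEMENT. It is step 2/3 of an RH-free proof attempt of Connes' Fact 6.4
(`prolateGuess_tendsto_riemannXi`, file `ConnesProlateGuess`), and uses nothing but the
structure `IsProlateFunction lam n f` (a real `C²` solution of the prolate equation
`−((λ²−x²)f′)′ + (2πλx)² f = χ f` on `(−λ, λ)` with exactly `n` zeros there, `∫ f² = 1`,
`f(0) > 0`, `f = 0` off `[−λ, λ]`) together with the turning-point / Riccati estimates of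
`ConnesProlateGuessTurning`.

## Main results (namespace `IsProlateFunction`, `n ∈ {0, 4}`)

* `picone₁_lt`, `picone₂_lt`: the two Picone identities. With `u'' = q_u u` and `f ≠ 0` on
  `[a, b]`, `Φ₁ = λ² u u′ − u² (λ²−x²) f′/f` is strictly increasing where
  `(2πλx)² − χ < λ² q_u`; with `v'' = q_v v`, `v ≠ 0` on `[a, b]` and a constant
  `0 ≤ c ≤ λ² − b²`, `Φ₂ = f (λ²−x²) f′ − c f² v′/v` is strictly increasing where
  `c q_v < (2πλx)² − χ`. Consequences `exists_zero_of_picone₁/₂` (Sturm separation).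
* `false_of_three_zeros`, `exists_zeros_of_four`: a `4`-zero prolate function has exactly two
  zeros in `(0, λ)` (evenness), `sq_lt_eigen_of_zero`: zeros lie before the turning point.
* `eigen_lt_of_zero : χ < 22λ²` (`λ ≥ 1`), `eigen_lt_of_four : χ < 102λ²` (`λ ≥ 2`),
  `eigen_pos_of_four : 0 < χ` — a-priori bounds by comparison with `cos kx`.
* `eigen_upper_zero/four`, `eigen_lower_zero/four` and the summary statements
  `eigen_tendsto_of_zero : ∀ δ > 0, ∃ Λ, ∀ λ ≥ Λ, |χ/λ² − 2π| ≤ δ`,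
  `eigen_tendsto_of_four : … |χ/λ² − 18π| ≤ δ`, uniformly in the prolate data: the classical
  asymptotics `χ_n(c)/c → 2n+1` of Slepian–Pollak (here `c = 2πλ²`, so `χ_n/λ² → 2π(2n+1)`).

## Method

Upper pinning compares `f` with the rescaled Hermite function `u = h_n(κx)`, `κ² ≈ 1 + δ/μ_n`
(`μ_0 = 2π`, `μ_4 = 18π`), whose equation `u'' = κ²(4π²κ²x² − μ_n) u` has a smaller potential
than the prolate one as soon as `χ > (μ_n + δ)λ²`; Sturm steps on `[0, y₁/κ]`, `[y₁/κ, y₂/κ]`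
(`y₁ < y₂` the positive zeros of `h_4`, `hermiteZero₁/₂`) and a truncated last step on
`[y₂/κ, X]` closed by the sign of `Φ₁(X)` (logarithmic derivative of `h_n` versus
`riccati_upper`) produce three zeros of `f` in `(0, λ)`, contradicting `exists_zeros_of_four`
(for `n = 0`: one step on `[0, X]` against `f > 0`). Lower pinning swaps the roles
(`v = h_n(κx)`, `κ² ≈ 1 − δ/μ_n`, weight constant `c = λ² − X²`, last step closed by
`riccati_lower`) and produces three positive zeros of `h_4(κ·)`, contradicting
`hermiteH4_three_zeros`. The comparison parameters `k`, `κ` are taken generic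
(`exists_generic_mul`) so that zeros of `f` and of the comparison function never coincide.
All thresholds `X(δ)`, `Λ(δ)` are explicit. [cite: SlepianPollak1961, §III;
Connes2026Letter, §6.3 (arXiv:2602.04022); folklore (Sturm–Picone comparison)]
-/

noncomputable section

open Real Set MeasureTheory Filter Topology intervalIntegral

namespace Literature.NumberTheory.LFunctions

/-! ### Generic parameters and Hermite/cosine comparison functions -/

/-- A parameter `κ ∈ (a, b)` avoiding the finitely many values `y/ζ` (`y ∈ ys`, `ζ ∈ S`, `S`
finite): then no point of `S` is a zero `y/κ` of the rescaled comparison function. [folklore] -/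
theorem exists_generic_mul {S : Set ℝ} (hS : S.Finite) (ys : Finset ℝ) {a b : ℝ} (hab : a < b) :
    ∃ κ ∈ Ioo a b, ∀ ζ ∈ S, ζ ≠ 0 → ∀ y ∈ ys, κ * ζ ≠ y := by
  set B : Set ℝ := (fun p : ℝ × ℝ ↦ p.1 / p.2) '' ((↑ys : Set ℝ) ×ˢ S) with hB
  have hBf : B.Finite := (ys.finite_toSet.prod hS).image _
  obtain ⟨κ, hκ, hκB⟩ := (Ioo_infinite hab).exists_notMem_finite hBf
  refine ⟨κ, hκ, fun ζ hζ hζ0 y hy h ↦ hκB ⟨(y, ζ), ⟨hy, hζ⟩, ?_⟩⟩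
  simp only
  rw [← h]
  field_simp

/-- The positive zero `y₁ = √((3−√6)/(4π))` of `h_4` (local notation, to keep this file free of
definitions). [folklore] -/
local notation "hermiteZero₁" => Real.sqrt ((3 - Real.sqrt 6) / (4 * π))

/-- The positive zero `y₂ = √((3+√6)/(4π))` of `h_4` (local notation). [folklore] -/
local notation "hermiteZero₂" => Real.sqrt ((3 + Real.sqrt 6) / (4 * π))

/-- `√6 < 5/2`. [folklore] -/
theorem sqrt_six_lt : Real.sqrt 6 < 5 / 2 := by
  rw [Real.sqrt_lt' (by norm_num)]; norm_num

/-- `2 < √6`. [folklore] -/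
theorem sqrt_six_gt : 2 < Real.sqrt 6 := by
  rw [Real.lt_sqrt (by norm_num)]; norm_num

/-- `0 < y₁`. [folklore] -/
theorem hermiteZero₁_pos : 0 < hermiteZero₁ := by
  have := sqrt_six_lt
  exact Real.sqrt_pos.2 (div_pos (by linarith) (by positivity))

/-- `y₁² = (3 − √6)/(4π)`. [folklore] -/
theorem hermiteZero₁_sq : hermiteZero₁ ^ 2 = (3 - Real.sqrt 6) / (4 * π) := by
  have := sqrt_six_lt
  rw [Real.sq_sqrt (div_pos (by linarith) (by positivity)).le]

/-- `y₂² = (3 + √6)/(4π)`. [folklore] -/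
theorem hermiteZero₂_sq : hermiteZero₂ ^ 2 = (3 + Real.sqrt 6) / (4 * π) := by
  rw [Real.sq_sqrt (by positivity)]

/-- `y₁ < y₂`. [folklore] -/
theorem hermiteZero₁_lt_hermiteZero₂ : hermiteZero₁ < hermiteZero₂ := by
  have := sqrt_six_lt
  have h6 : 0 < Real.sqrt 6 := Real.sqrt_pos.2 (by norm_num)
  have hπ := Real.pi_pos
  apply Real.sqrt_lt_sqrt (div_pos (by linarith) (by positivity)).le
  rw [div_lt_div_iff_of_pos_right (by positivity)]
  linarith

/-- `0 < y₂`. [folklore] -/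
theorem hermiteZero₂_pos : 0 < hermiteZero₂ := hermiteZero₁_pos.trans hermiteZero₁_lt_hermiteZero₂

/-- `y₂ < 1`. [folklore] -/
theorem hermiteZero₂_lt_one : hermiteZero₂ < 1 := by
  have := sqrt_six_lt
  have hπ := Real.pi_gt_three
  rw [Real.sqrt_lt' one_pos, div_lt_iff₀ (by positivity)]
  nlinarith

/-- `(√6)² = 6`. [folklore] -/
theorem sq_sqrt_six : Real.sqrt 6 ^ 2 = 6 := Real.sq_sqrt (by norm_num)

/-- Factorisation of the polynomial part of `h_4`:
`16π²x⁴ − 24πx² + 3 = 16π²(x² − y₁²)(x² − y₂²)`. [folklore] -/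
theorem hermite_poly_factor (x : ℝ) :
    16 * π ^ 2 * x ^ 4 - 24 * π * x ^ 2 + 3
      = 16 * π ^ 2 * (x ^ 2 - hermiteZero₁ ^ 2) * (x ^ 2 - hermiteZero₂ ^ 2) := by
  rw [hermiteZero₁_sq, hermiteZero₂_sq]
  have hπ := Real.pi_pos
  field_simp
  have h6 := sq_sqrt_six
  ring_nf
  nlinarith [h6]

/-- `h_4 = poly · e^{−πx²}/(16A)`. [folklore] -/
theorem hermiteH4_eq (x : ℝ) : hermiteH4 x
    = (16 * π ^ 2 * x ^ 4 - 24 * π * x ^ 2 + 3) * (Real.exp (-π * x ^ 2) / (16 * prolateGuessA)) := by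
  unfold hermiteH4; ring

/-- `h₄'` with the Gaussian factored out. [folklore] -/
theorem hermiteH4'_eq (x : ℝ) : hermiteH4' x
    = (-32 * π ^ 3 * x ^ 5 + 112 * π ^ 2 * x ^ 3 - 54 * π * x)
      * (Real.exp (-π * x ^ 2) / (16 * prolateGuessA)) := by
  unfold hermiteH4'; ring

/-- `h₀' = −2πx · h₀`. [folklore] -/
theorem hermiteH0'_eq (x : ℝ) : hermiteH0' x = -(2 * π * x) * hermiteH0 x := by
  unfold hermiteH0' hermiteH0; ring

/-- `h₄(y₁) = 0`. [folklore] -/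
theorem hermiteH4_hermiteZero₁ : hermiteH4 hermiteZero₁ = 0 := by
  rw [hermiteH4_eq, hermite_poly_factor]; simp

/-- `h₄(y₂) = 0`. [folklore] -/
theorem hermiteH4_hermiteZero₂ : hermiteH4 hermiteZero₂ = 0 := by
  rw [hermiteH4_eq, hermite_poly_factor]; simp

/-- `h_4(x) ≠ 0` for `x ≥ 0`, `x ≠ y₁, y₂`. [folklore] -/
theorem hermiteH4_ne_zero {x : ℝ} (hx : 0 ≤ x) (h₁ : x ≠ hermiteZero₁) (h₂ : x ≠ hermiteZero₂) :
    hermiteH4 x ≠ 0 := by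
  rw [hermiteH4_eq, hermite_poly_factor]
  have hA := prolateGuessA_pos
  have hπ := Real.pi_pos
  have e : 0 < Real.exp (-π * x ^ 2) / (16 * prolateGuessA) := by positivity
  have s₁ : x ^ 2 - hermiteZero₁ ^ 2 ≠ 0 := by
    intro h
    have : (x - hermiteZero₁) * (x + hermiteZero₁) = 0 := by nlinarith
    rcases mul_eq_zero.1 this with h' | h'
    · exact h₁ (by linarith)
    · linarith [hermiteZero₁_pos]
  have s₂ : x ^ 2 - hermiteZero₂ ^ 2 ≠ 0 := by
    intro h
    have : (x - hermiteZero₂) * (x + hermiteZero₂) = 0 := by nlinarith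
    rcases mul_eq_zero.1 this with h' | h'
    · exact h₂ (by linarith)
    · linarith [hermiteZero₂_pos]
  exact mul_ne_zero (mul_ne_zero (mul_ne_zero (by positivity) s₁) s₂) e.ne'

/-- `h_4(κ·)` cannot vanish at three distinct positive points. [folklore] -/
theorem hermiteH4_three_zeros {κ t₁ t₂ t₃ : ℝ} (hκ : 0 < κ) (h₁ : 0 < t₁) (h₂ : 0 < t₂) (h₃ : 0 < t₃)
    (h12 : t₁ ≠ t₂) (h13 : t₁ ≠ t₃) (h23 : t₂ ≠ t₃) (hz₁ : hermiteH4 (κ * t₁) = 0)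
    (hz₂ : hermiteH4 (κ * t₂) = 0) (hz₃ : hermiteH4 (κ * t₃) = 0) : False := by
  have key : ∀ t, 0 < t → hermiteH4 (κ * t) = 0 → κ * t = hermiteZero₁ ∨ κ * t = hermiteZero₂ := by
    intro t ht hz
    by_contra h
    push Not at h
    exact hermiteH4_ne_zero (by positivity) h.1 h.2 hz
  have hκ' := hκ.ne'
  rcases key t₁ h₁ hz₁ with a | a <;> rcases key t₂ h₂ hz₂ with b | b <;>
    rcases key t₃ h₃ hz₃ with c | c
  all_goals first
    | exact h12 (mul_left_cancel₀ hκ' (a.trans b.symm))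
    | exact h13 (mul_left_cancel₀ hκ' (a.trans c.symm))
    | exact h23 (mul_left_cancel₀ hκ' (b.trans c.symm))

/-- `h_4 > 0` on `[1, ∞)`. [folklore] -/
theorem hermiteH4_pos_of_one_le {x : ℝ} (hx : 1 ≤ x) : 0 < hermiteH4 x := by
  have hA := prolateGuessA_pos
  have hπ := Real.pi_gt_three
  have hP : 0 < 16 * π ^ 2 * x ^ 4 - 24 * π * x ^ 2 + 3 := by
    have hx2 : 1 ≤ x ^ 2 := by nlinarith
    have : 0 ≤ 8 * π * x ^ 2 * (2 * π * x ^ 2 - 3) := by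
      have : 0 ≤ 2 * π * x ^ 2 - 3 := by nlinarith
      positivity
    nlinarith
  rw [hermiteH4_eq]
  positivity

/-- `h_4(0) > 0`. [folklore] -/
theorem hermiteH4_zero_pos : 0 < hermiteH4 0 := by
  have hA := prolateGuessA_pos
  rw [hermiteH4_eq]; norm_num; positivity

/-- Logarithmic derivative of `h_4` beyond its zeros, upper side: for `y ≥ 1`,
`h_4′(y)h_4(y)·y ≤ (−2πy² + 8)h_4(y)²`. [folklore] -/
theorem hermiteH4'_mul_le {y : ℝ} (hy : 1 ≤ y) :
    hermiteH4' y * hermiteH4 y * y ≤ (-2 * π * y ^ 2 + 8) * hermiteH4 y ^ 2 := by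
  rw [hermiteH4_eq, hermiteH4'_eq]
  have hA := prolateGuessA_pos
  have hπ := Real.pi_gt_three
  set E := Real.exp (-π * y ^ 2) / (16 * prolateGuessA) with hE
  have hE0 : 0 < E := by positivity
  have hP : 0 < 16 * π ^ 2 * y ^ 4 - 24 * π * y ^ 2 + 3 := by
    have : 0 ≤ 8 * π * y ^ 2 * (2 * π * y ^ 2 - 3) := by
      have : 0 ≤ 2 * π * y ^ 2 - 3 := by nlinarith
      positivity
    nlinarith
  -- the polynomial inequality `N·y ≤ (−2πy² + 8)·P`, i.e. `0 ≤ 64π²y⁴ − 144πy² + 24`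
  have key : (-32 * π ^ 3 * y ^ 5 + 112 * π ^ 2 * y ^ 3 - 54 * π * y) * y
      ≤ (-2 * π * y ^ 2 + 8) * (16 * π ^ 2 * y ^ 4 - 24 * π * y ^ 2 + 3) := by
    have hy2 : 1 ≤ y ^ 2 := by nlinarith
    nlinarith [mul_nonneg (mul_nonneg (by positivity : (0:ℝ) ≤ 64 * π) (sub_nonneg.2 hy2))
      (by positivity : (0:ℝ) ≤ y ^ 2)]
  have := mul_le_mul_of_nonneg_right key (le_of_lt (mul_pos (mul_pos hE0 hE0) hP))
  nlinarith [this]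

/-- Logarithmic derivative of `h_4` beyond its zeros, lower side: for `y ≥ 1`,
`−2πy·h_4(y)² ≤ h_4′(y)h_4(y)` (`P₄′/P₄ ≥ 0`). [folklore] -/
theorem hermiteH4'_mul_ge {y : ℝ} (hy : 1 ≤ y) :
    -(2 * π * y) * hermiteH4 y ^ 2 ≤ hermiteH4' y * hermiteH4 y := by
  rw [hermiteH4_eq, hermiteH4'_eq]
  have hA := prolateGuessA_pos
  have hπ := Real.pi_gt_three
  set E := Real.exp (-π * y ^ 2) / (16 * prolateGuessA) with hE
  have hE0 : 0 < E := by positivity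
  have hP : 0 < 16 * π ^ 2 * y ^ 4 - 24 * π * y ^ 2 + 3 := by
    have : 0 ≤ 8 * π * y ^ 2 * (2 * π * y ^ 2 - 3) := by
      have : 0 ≤ 2 * π * y ^ 2 - 3 := by nlinarith
      positivity
    nlinarith
  have key : -(2 * π * y) * (16 * π ^ 2 * y ^ 4 - 24 * π * y ^ 2 + 3)
      ≤ -32 * π ^ 3 * y ^ 5 + 112 * π ^ 2 * y ^ 3 - 54 * π * y := by
    have : 0 ≤ 16 * π * y * (4 * π * y ^ 2 - 3) := by
      have : 0 ≤ 4 * π * y ^ 2 - 3 := by nlinarith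
      have : 0 ≤ y := by linarith
      positivity
    nlinarith
  have := mul_le_mul_of_nonneg_right key (le_of_lt (mul_pos (mul_pos hE0 hE0) hP))
  nlinarith [this]

/-- The rescaled Hermite function `x ↦ h_4(κx)`: derivatives. [folklore] -/
theorem hasDerivAt_hermiteH4_comp (κ x : ℝ) :
    HasDerivAt (fun t ↦ hermiteH4 (κ * t)) (κ * hermiteH4' (κ * x)) x := by
  have h := HasDerivAt.comp x (hasDerivAt_hermiteH4 (κ * x)) ((hasDerivAt_id' x).const_mul κ)
  exact h.congr_deriv (by ring)

/-- Second derivative of `h₄(κx)`: `(κ h₄'(κx))' = κ²(4π²(κx)² − 18π) h₄(κx)`. [folklore] -/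
theorem hasDerivAt_hermiteH4'_comp (κ x : ℝ) :
    HasDerivAt (fun t ↦ κ * hermiteH4' (κ * t))
      (κ ^ 2 * (4 * π ^ 2 * (κ * x) ^ 2 - 18 * π) * hermiteH4 (κ * x)) x := by
  have h := (HasDerivAt.comp x (hasDerivAt_hermiteH4' (κ * x))
    ((hasDerivAt_id' x).const_mul κ)).const_mul κ
  exact h.congr_deriv (by ring)

/-- Derivative of `h₀(κx)`. [folklore] -/
theorem hasDerivAt_hermiteH0_comp (κ x : ℝ) :
    HasDerivAt (fun t ↦ hermiteH0 (κ * t)) (κ * hermiteH0' (κ * x)) x := by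
  have h := HasDerivAt.comp x (hasDerivAt_hermiteH0 (κ * x)) ((hasDerivAt_id' x).const_mul κ)
  exact h.congr_deriv (by ring)

/-- Second derivative of `h₀(κx)`: `(κ h₀'(κx))' = κ²(4π²(κx)² − 2π) h₀(κx)`. [folklore] -/
theorem hasDerivAt_hermiteH0'_comp (κ x : ℝ) :
    HasDerivAt (fun t ↦ κ * hermiteH0' (κ * t))
      (κ ^ 2 * (4 * π ^ 2 * (κ * x) ^ 2 - 2 * π) * hermiteH0 (κ * x)) x := by
  have h := (HasDerivAt.comp x (hasDerivAt_hermiteH0' (κ * x))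
    ((hasDerivAt_id' x).const_mul κ)).const_mul κ
  exact h.congr_deriv (by ring)

/-- The comparison function `cos(kx)`: derivatives. [folklore] -/
theorem hasDerivAt_cos_comp (k x : ℝ) :
    HasDerivAt (fun t ↦ Real.cos (k * t)) (-(k * Real.sin (k * x))) x :=
  (((hasDerivAt_id' x).const_mul k).cos).congr_deriv (by ring)

/-- Second derivative of `cos kx`. [folklore] -/
theorem hasDerivAt_cos'_comp (k x : ℝ) :
    HasDerivAt (fun t ↦ -(k * Real.sin (k * t))) (-k ^ 2 * Real.cos (k * x)) x :=
  ((((hasDerivAt_id' x).const_mul k).sin).const_mul k).neg.congr_deriv (by ring)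

/-! ### Picone identities and Sturm comparison steps -/

namespace IsProlateFunction

variable {lam : ℝ} {n : ℕ} {f : ℝ → ℝ}

/-- **Picone identity I** (explicit `u` with `u″ = q_u·u`, prolate `f ≠ 0`):
`Φ₁ = λ²uu′ − u²(λ²−x²)f′/f` has
`Φ₁′ = x²u′² + (λ²−x²)(u′ − uf′/f)² + (λ²q_u + χ − (2πλx)²)u²`. [folklore] -/
theorem hasDerivAt_picone₁ (hf : IsProlateFunction lam n f) {χ : ℝ}
    (hχ : ∀ x ∈ Ioo (-lam) lam,
      -(deriv (fun y ↦ (lam ^ 2 - y ^ 2) * deriv f y) x) + (2 * π * lam * x) ^ 2 * f x = χ * f x)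
    {u u' qu : ℝ → ℝ} (hu : ∀ x, HasDerivAt u (u' x) x) (hu' : ∀ x, HasDerivAt u' (qu x * u x) x)
    {x : ℝ} (hx : x ∈ Ioo (-lam) lam) (hfx : f x ≠ 0) :
    HasDerivAt (fun t ↦ lam ^ 2 * (u t * u' t) - u t ^ 2 * ((lam ^ 2 - t ^ 2) * deriv f t) / f t)
      (x ^ 2 * u' x ^ 2 + (lam ^ 2 - x ^ 2) * (u' x - u x * deriv f x / f x) ^ 2
        + (lam ^ 2 * qu x + χ - (2 * π * lam * x) ^ 2) * u x ^ 2) x := by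
  have h1 : HasDerivAt (fun t ↦ lam ^ 2 * (u t * u' t))
      (lam ^ 2 * (u' x * u' x + u x * (qu x * u x))) x := ((hu x).mul (hu' x)).const_mul _
  have hP := hf.hasDerivAt_sqMulDeriv hχ hx
  have hfd := (hf.differentiableAt hx).hasDerivAt
  have hu2 : HasDerivAt (fun t ↦ u t ^ 2) (2 * u x * u' x) x := by
    have h := (hu x).mul (hu x)
    have e : (fun t ↦ u t ^ 2) = u * u := by funext t; simp [sq]
    rw [e]
    exact h.congr_deriv (by ring)
  have h2 := (hu2.mul hP).div hfd hfx
  have h := h1.sub h2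
  refine h.congr_deriv ?_
  simp only [Pi.mul_apply]
  field_simp
  ring

/-- **Sturm step I**: on `[a, b] ⊆ [0, λ)` with `f ≠ 0` on `[a, b]`, `u ≠ 0` on `(a, b)` and positive
gap `λ²q_u + χ − (2πλx)² > 0` on `(a, b)`: `Φ₁(a) < Φ₁(b)`. [folklore] -/
theorem picone₁_lt (hf : IsProlateFunction lam n f) {χ : ℝ}
    (hχ : ∀ x ∈ Ioo (-lam) lam,
      -(deriv (fun y ↦ (lam ^ 2 - y ^ 2) * deriv f y) x) + (2 * π * lam * x) ^ 2 * f x = χ * f x)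
    {u u' qu : ℝ → ℝ} (hu : ∀ x, HasDerivAt u (u' x) x) (hu' : ∀ x, HasDerivAt u' (qu x * u x) x)
    {a b : ℝ} (h0a : 0 ≤ a) (hab : a < b) (hbl : b < lam) (hfne : ∀ x ∈ Icc a b, f x ≠ 0)
    (hune : ∀ x ∈ Ioo a b, u x ≠ 0)
    (hgap : ∀ x ∈ Ioo a b, (2 * π * lam * x) ^ 2 - χ < lam ^ 2 * qu x) :
    lam ^ 2 * (u a * u' a) - u a ^ 2 * ((lam ^ 2 - a ^ 2) * deriv f a) / f a
      < lam ^ 2 * (u b * u' b) - u b ^ 2 * ((lam ^ 2 - b ^ 2) * deriv f b) / f b := by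
  have hI : ∀ x ∈ Icc a b, x ∈ Ioo (-lam) lam := fun x hx ↦
    ⟨by linarith [hf.lam_pos, hx.1], lt_of_le_of_lt hx.2 hbl⟩
  have hd := fun x (hx : x ∈ Icc a b) ↦ hf.hasDerivAt_picone₁ hχ hu hu' (hI x hx) (hfne x hx)
  refine strictMonoOn_of_deriv_pos (convex_Icc a b)
    (fun x hx ↦ (hd x hx).continuousAt.continuousWithinAt) (fun x hx ↦ ?_)
    (left_mem_Icc.2 hab.le) (right_mem_Icc.2 hab.le) hab
  rw [interior_Icc] at hx
  rw [(hd x (Ioo_subset_Icc_self hx)).deriv]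
  have hux := hune x hx
  have h1 : 0 ≤ x ^ 2 * u' x ^ 2 := by positivity
  have h2 : 0 ≤ (lam ^ 2 - x ^ 2) * (u' x - u x * deriv f x / f x) ^ 2 :=
    mul_nonneg (by nlinarith [hx.1, hx.2]) (sq_nonneg _)
  have h3 : 0 < (lam ^ 2 * qu x + χ - (2 * π * lam * x) ^ 2) * u x ^ 2 :=
    mul_pos (by linarith [hgap x hx]) (by positivity)
  linarith

/-- **Picone identity II** (prolate `f`, explicit `v ≠ 0` with `v″ = q_v·v`, constant `c`):
`Φ₂ = f·(λ²−x²)f′ − c f² v′/v` has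
`Φ₂′ = (λ²−x²−c)f′² + c(f′ − fv′/v)² + ((2πλx)² − χ − c q_v)f²`. [folklore] -/
theorem hasDerivAt_picone₂ (hf : IsProlateFunction lam n f) {χ : ℝ}
    (hχ : ∀ x ∈ Ioo (-lam) lam,
      -(deriv (fun y ↦ (lam ^ 2 - y ^ 2) * deriv f y) x) + (2 * π * lam * x) ^ 2 * f x = χ * f x)
    {v v' qv : ℝ → ℝ} (hv : ∀ x, HasDerivAt v (v' x) x) (hv' : ∀ x, HasDerivAt v' (qv x * v x) x)
    (c : ℝ) {x : ℝ} (hx : x ∈ Ioo (-lam) lam) (hvx : v x ≠ 0) :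
    HasDerivAt (fun t ↦ f t * ((lam ^ 2 - t ^ 2) * deriv f t) - c * f t ^ 2 * v' t / v t)
      ((lam ^ 2 - x ^ 2 - c) * deriv f x ^ 2 + c * (deriv f x - f x * v' x / v x) ^ 2
        + ((2 * π * lam * x) ^ 2 - χ - c * qv x) * f x ^ 2) x := by
  have hP := hf.hasDerivAt_sqMulDeriv hχ hx
  have hfd := (hf.differentiableAt hx).hasDerivAt
  have h1 := hfd.mul hP
  have hf2 : HasDerivAt (fun t ↦ f t ^ 2) (2 * f x * deriv f x) x := by
    have h := hfd.mul hfd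
    have e : (fun t ↦ f t ^ 2) = f * f := by funext t; simp [sq]
    rw [e]
    exact h.congr_deriv (by ring)
  have h2 := (((hf2.const_mul c).mul (hv' x)).div (hv x) hvx)
  have h := h1.sub h2
  refine h.congr_deriv ?_
  simp only [Pi.mul_apply]
  field_simp
  ring

/-- **Sturm step II**: on `[a, b] ⊆ [0, λ)` with `v ≠ 0` on `[a, b]`, `f ≠ 0` on `(a, b)`,
`0 ≤ c ≤ λ² − b²` and positive gap `(2πλx)² − χ − c q_v > 0` on `(a, b)`: `Φ₂(a) < Φ₂(b)`.
[folklore] -/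
theorem picone₂_lt (hf : IsProlateFunction lam n f) {χ : ℝ}
    (hχ : ∀ x ∈ Ioo (-lam) lam,
      -(deriv (fun y ↦ (lam ^ 2 - y ^ 2) * deriv f y) x) + (2 * π * lam * x) ^ 2 * f x = χ * f x)
    {v v' qv : ℝ → ℝ} (hv : ∀ x, HasDerivAt v (v' x) x) (hv' : ∀ x, HasDerivAt v' (qv x * v x) x)
    {c a b : ℝ} (hc : 0 ≤ c) (h0a : 0 ≤ a) (hab : a < b) (hbl : b < lam)
    (hcb : c ≤ lam ^ 2 - b ^ 2) (hvne : ∀ x ∈ Icc a b, v x ≠ 0) (hfne : ∀ x ∈ Ioo a b, f x ≠ 0)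
    (hgap : ∀ x ∈ Ioo a b, c * qv x < (2 * π * lam * x) ^ 2 - χ) :
    f a * ((lam ^ 2 - a ^ 2) * deriv f a) - c * f a ^ 2 * v' a / v a
      < f b * ((lam ^ 2 - b ^ 2) * deriv f b) - c * f b ^ 2 * v' b / v b := by
  have hI : ∀ x ∈ Icc a b, x ∈ Ioo (-lam) lam := fun x hx ↦
    ⟨by linarith [hf.lam_pos, hx.1], lt_of_le_of_lt hx.2 hbl⟩
  have hd := fun x (hx : x ∈ Icc a b) ↦ hf.hasDerivAt_picone₂ hχ hv hv' c (hI x hx) (hvne x hx)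
  refine strictMonoOn_of_deriv_pos (convex_Icc a b)
    (fun x hx ↦ (hd x hx).continuousAt.continuousWithinAt) (fun x hx ↦ ?_)
    (left_mem_Icc.2 hab.le) (right_mem_Icc.2 hab.le) hab
  rw [interior_Icc] at hx
  rw [(hd x (Ioo_subset_Icc_self hx)).deriv]
  have hfx := hfne x hx
  have h1 : 0 ≤ (lam ^ 2 - x ^ 2 - c) * deriv f x ^ 2 :=
    mul_nonneg (by nlinarith [hx.1, hx.2]) (sq_nonneg _)
  have h2 : 0 ≤ c * (deriv f x - f x * v' x / v x) ^ 2 := mul_nonneg hc (sq_nonneg _)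
  have h3 : 0 < ((2 * π * lam * x) ^ 2 - χ - c * qv x) * f x ^ 2 :=
    mul_pos (by linarith [hgap x hx]) (by positivity)
  linarith

/-! ### Zero structure of `h_{0,λ}` and `h_{4,λ}` -/

/-- Three distinct zeros of `h_{4,λ}` in `(0, λ)` are impossible (with their negatives they would be
six). [folklore] -/
theorem false_of_three_zeros (hf : IsProlateFunction lam 4 f) {t₁ t₂ t₃ : ℝ} (h₁ : t₁ ∈ Ioo 0 lam)
    (h₂ : t₂ ∈ Ioo 0 lam) (h₃ : t₃ ∈ Ioo 0 lam) (h12 : t₁ < t₂) (h23 : t₂ < t₃)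
    (hz₁ : f t₁ = 0) (hz₂ : f t₂ = 0) (hz₃ : f t₃ = 0) : False := by
  have he := hf.even
  have hlam := hf.lam_pos
  set Z := {x : ℝ | x ∈ Ioo (-lam) lam ∧ f x = 0} with hZ
  let T : Finset ℝ := {t₁, t₂, t₃, -t₁, -t₂, -t₃}
  have hTZ : (↑T : Set ℝ) ⊆ Z := by
    intro y hy
    simp only [T, Finset.coe_insert, Finset.coe_singleton, mem_insert_iff, mem_singleton_iff] at hy
    rcases hy with rfl | rfl | rfl | rfl | rfl | rfl
    · exact ⟨⟨by linarith [h₁.1], h₁.2⟩, hz₁⟩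
    · exact ⟨⟨by linarith [h₂.1], h₂.2⟩, hz₂⟩
    · exact ⟨⟨by linarith [h₃.1], h₃.2⟩, hz₃⟩
    · exact ⟨⟨by linarith [h₁.2], by linarith [h₁.1]⟩, by rw [he]; exact hz₁⟩
    · exact ⟨⟨by linarith [h₂.2], by linarith [h₂.1]⟩, by rw [he]; exact hz₂⟩
    · exact ⟨⟨by linarith [h₃.2], by linarith [h₃.1]⟩, by rw [he]; exact hz₃⟩
  have hTcard : T.card = 6 := by
    have n12 : t₁ ≠ t₂ := by intro h; linarith
    have n13 : t₁ ≠ t₃ := by intro h; linarith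
    have n14 : t₁ ≠ -t₁ := by intro h; linarith [h₁.1]
    have n15 : t₁ ≠ -t₂ := by intro h; linarith [h₁.1, h₂.1]
    have n16 : t₁ ≠ -t₃ := by intro h; linarith [h₁.1, h₃.1]
    have n23 : t₂ ≠ t₃ := by intro h; linarith
    have n24 : t₂ ≠ -t₁ := by intro h; linarith [h₁.1, h₂.1]
    have n25 : t₂ ≠ -t₂ := by intro h; linarith [h₂.1]
    have n26 : t₂ ≠ -t₃ := by intro h; linarith [h₂.1, h₃.1]
    have n34 : t₃ ≠ -t₁ := by intro h; linarith [h₁.1, h₃.1]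
    have n35 : t₃ ≠ -t₂ := by intro h; linarith [h₂.1, h₃.1]
    have n36 : t₃ ≠ -t₃ := by intro h; linarith [h₃.1]
    have n45 : -t₁ ≠ -t₂ := by intro h; linarith
    have n46 : -t₁ ≠ -t₃ := by intro h; linarith
    have n56 : -t₂ ≠ -t₃ := by intro h; linarith
    simp only [T, Finset.card_insert_of_notMem, Finset.mem_insert, Finset.mem_singleton, n12, n13,
      n14, n15, n16, n23, n24, n25, n26, n34, n35, n36, n45, n46, n56, or_self, not_false_eq_true,
      Finset.card_singleton]
  have h6 : 6 ≤ Z.ncard := by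
    rw [← hTcard, ← Set.ncard_coe_finset]
    exact Set.ncard_le_ncard hTZ hf.zeros_finite
  rw [hf.zeros_card] at h6
  omega

/-- The zeros of `h_{4,λ}`: exactly two positive ones `0 < ζ₁ < ζ₂ < λ`. [folklore] -/
theorem exists_zeros_of_four (hf : IsProlateFunction lam 4 f) :
    ∃ ζ₁ ζ₂ : ℝ, 0 < ζ₁ ∧ ζ₁ < ζ₂ ∧ ζ₂ < lam ∧ f ζ₁ = 0 ∧ f ζ₂ = 0 ∧
      ∀ t ∈ Ioo 0 lam, f t = 0 → t = ζ₁ ∨ t = ζ₂ := by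
  have he := hf.even
  have hlam := hf.lam_pos
  set Z := {x : ℝ | x ∈ Ioo (-lam) lam ∧ f x = 0} with hZ
  set Zp := {x : ℝ | x ∈ Ioo 0 lam ∧ f x = 0} with hZp
  have hZpZ : Zp ⊆ Z := fun x hx ↦ ⟨⟨by linarith [hx.1.1], hx.1.2⟩, hx.2⟩
  have hZpf : Zp.Finite := hf.zeros_finite.subset hZpZ
  have hcover : Z ⊆ Zp ∪ (fun x ↦ -x) '' Zp := by
    intro z hz
    have hz0 : z ≠ 0 := by intro h; rw [h] at hz; exact absurd hz.2 hf.pos_zero.ne'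
    rcases lt_or_gt_of_ne hz0 with h | h
    · right; exact ⟨-z, ⟨⟨by linarith, by linarith [hz.1.1]⟩, by rw [he]; exact hz.2⟩, by ring⟩
    · left; exact ⟨⟨h, hz.1.2⟩, hz.2⟩
  have hge : 2 ≤ Zp.ncard := by
    have h1 : Z.ncard ≤ (Zp ∪ (fun x ↦ -x) '' Zp).ncard :=
      Set.ncard_le_ncard hcover (hZpf.union (hZpf.image _))
    have h2 := Set.ncard_union_le Zp ((fun x : ℝ ↦ -x) '' Zp)
    have h3 := Set.ncard_image_le (f := fun x : ℝ ↦ -x) hZpf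
    rw [hf.zeros_card] at h1
    omega
  have hle : Zp.ncard ≤ 2 := by
    by_contra h
    obtain ⟨a, ha, b, hb, c, hc, hab, hac, hbc⟩ := (Set.two_lt_ncard hZpf).1 (by omega)
    -- order the three points
    rcases lt_or_gt_of_ne hab with hab' | hab' <;> rcases lt_or_gt_of_ne hac with hac' | hac' <;>
      rcases lt_or_gt_of_ne hbc with hbc' | hbc'
    all_goals first
      | exact hf.false_of_three_zeros ha.1 hb.1 hc.1 hab' hbc' ha.2 hb.2 hc.2
      | exact hf.false_of_three_zeros ha.1 hc.1 hb.1 hac' hbc' ha.2 hc.2 hb.2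
      | exact hf.false_of_three_zeros hb.1 ha.1 hc.1 hab' hac' hb.2 ha.2 hc.2
      | exact hf.false_of_three_zeros hb.1 hc.1 ha.1 hbc' hac' hb.2 hc.2 ha.2
      | exact hf.false_of_three_zeros hc.1 ha.1 hb.1 hac' hab' hc.2 ha.2 hb.2
      | exact hf.false_of_three_zeros hc.1 hb.1 ha.1 hbc' hab' hc.2 hb.2 ha.2
  obtain ⟨x, y, hxy, hZxy⟩ := Set.ncard_eq_two.1 (le_antisymm hle hge)
  have hx : x ∈ Zp := by rw [hZxy]; exact mem_insert _ _
  have hy : y ∈ Zp := by rw [hZxy]; exact mem_insert_of_mem _ (mem_singleton _)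
  have key : ∀ t ∈ Ioo 0 lam, f t = 0 → t = x ∨ t = y := by
    intro t ht hft
    have : t ∈ Zp := ⟨ht, hft⟩
    rw [hZxy] at this
    simpa using this
  rcases lt_or_gt_of_ne hxy with h | h
  · exact ⟨x, y, hx.1.1, h, hy.1.2, hx.2, hy.2, key⟩
  · exact ⟨y, x, hy.1.1, h, hx.1.2, hy.2, hx.2, fun t ht hft ↦ (key t ht hft).symm⟩

/-- Zeros lie before the turning point: `f(ζ) = 0`, `0 ≤ ζ < λ` imply `(2πλζ)² < χ`. [folklore] -/
theorem sq_lt_eigen_of_zero (hf : IsProlateFunction lam n f) {χ : ℝ}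
    (hχ : ∀ x ∈ Ioo (-lam) lam,
      -(deriv (fun y ↦ (lam ^ 2 - y ^ 2) * deriv f y) x) + (2 * π * lam * x) ^ 2 * f x = χ * f x)
    {ζ : ℝ} (hζ : ζ ∈ Ico 0 lam) (hfζ : f ζ = 0) : (2 * π * lam * ζ) ^ 2 < χ := by
  by_contra h
  exact hf.ne_zero_of_turning hχ hζ.1 (not_lt.1 h) ⟨le_rfl, hζ.2⟩ hfζ

/-- Sturm step I as an existence statement: `u(a) = 0` (or `a = 0`, `u′(0) = 0`) and `u(b) = 0`
force a zero of `f` in `(a, b)` (given `f(a), f(b) ≠ 0`). [folklore] -/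
theorem exists_zero_of_picone₁ (hf : IsProlateFunction lam n f) {χ : ℝ}
    (hχ : ∀ x ∈ Ioo (-lam) lam,
      -(deriv (fun y ↦ (lam ^ 2 - y ^ 2) * deriv f y) x) + (2 * π * lam * x) ^ 2 * f x = χ * f x)
    {u u' qu : ℝ → ℝ} (hu : ∀ x, HasDerivAt u (u' x) x) (hu' : ∀ x, HasDerivAt u' (qu x * u x) x)
    {a b : ℝ} (h0a : 0 ≤ a) (hab : a < b) (hbl : b < lam) (hune : ∀ x ∈ Ioo a b, u x ≠ 0)
    (hgap : ∀ x ∈ Ioo a b, (2 * π * lam * x) ^ 2 - χ < lam ^ 2 * qu x)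
    (ha : u a = 0 ∨ (a = 0 ∧ u' 0 = 0)) (hb : u b = 0) (hfa : f a ≠ 0) (hfb : f b ≠ 0) :
    ∃ t ∈ Ioo a b, f t = 0 := by
  by_contra hcon
  push Not at hcon
  have hfne : ∀ x ∈ Icc a b, f x ≠ 0 := by
    intro x hx
    rcases eq_or_lt_of_le hx.1 with h | h
    · rw [← h]; exact hfa
    rcases eq_or_lt_of_le hx.2 with h' | h'
    · rw [h']; exact hfb
    exact hcon x ⟨h, h'⟩
  have h := hf.picone₁_lt hχ hu hu' h0a hab hbl hfne hune hgap
  rw [hb] at h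
  rcases ha with h0 | ⟨rfl, h0⟩
  · rw [h0] at h; simp at h
  · rw [h0, hf.deriv_zero] at h; simp at h

/-- Sturm step II as an existence statement: `f(a) = 0` (or `a = 0`, `v′(0) = 0`) and `f(b) = 0`
force a zero of `v` in `(a, b)` (given `v(a), v(b) ≠ 0`). [folklore] -/
theorem exists_zero_of_picone₂ (hf : IsProlateFunction lam n f) {χ : ℝ}
    (hχ : ∀ x ∈ Ioo (-lam) lam,
      -(deriv (fun y ↦ (lam ^ 2 - y ^ 2) * deriv f y) x) + (2 * π * lam * x) ^ 2 * f x = χ * f x)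
    {v v' qv : ℝ → ℝ} (hv : ∀ x, HasDerivAt v (v' x) x) (hv' : ∀ x, HasDerivAt v' (qv x * v x) x)
    {c a b : ℝ} (hc : 0 ≤ c) (h0a : 0 ≤ a) (hab : a < b) (hbl : b < lam)
    (hcb : c ≤ lam ^ 2 - b ^ 2) (hfne : ∀ x ∈ Ioo a b, f x ≠ 0)
    (hgap : ∀ x ∈ Ioo a b, c * qv x < (2 * π * lam * x) ^ 2 - χ)
    (ha : f a = 0 ∨ (a = 0 ∧ v' 0 = 0)) (hb : f b = 0) (hva : v a ≠ 0) (hvb : v b ≠ 0) :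
    ∃ t ∈ Ioo a b, v t = 0 := by
  by_contra hcon
  push Not at hcon
  have hvne : ∀ x ∈ Icc a b, v x ≠ 0 := by
    intro x hx
    rcases eq_or_lt_of_le hx.1 with h | h
    · rw [← h]; exact hva
    rcases eq_or_lt_of_le hx.2 with h' | h'
    · rw [h']; exact hvb
    exact hcon x ⟨h, h'⟩
  have h := hf.picone₂_lt hχ hv hv' hc h0a hab hbl hcb hvne hfne hgap
  rw [hb] at h
  rcases ha with h0 | ⟨rfl, h0⟩
  · rw [h0] at h; simp at h
  · rw [h0, hf.deriv_zero] at h; simp at h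

/-! ### A-priori eigenvalue bounds (comparison with `cos kx`) -/

/-- `π⁴ < 100`. [folklore] -/
theorem pi_pow_four_lt : π ^ 4 < 100 := by
  have h := Real.pi_lt_d2
  have h0 := Real.pi_pos
  have h2 : π ^ 2 < 3.15 ^ 2 := by nlinarith
  nlinarith [h2]

/-- `χ₀(λ) < 22λ²` for `λ ≥ 1` (else `h_{0,λ} > 0` would vanish in `(0, π/6)` by comparison with
`cos 3x`). [folklore] -/
theorem eigen_lt_of_zero (hf : IsProlateFunction lam 0 f) {χ : ℝ}
    (hχ : ∀ x ∈ Ioo (-lam) lam,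
      -(deriv (fun y ↦ (lam ^ 2 - y ^ 2) * deriv f y) x) + (2 * π * lam * x) ^ 2 * f x = χ * f x)
    (h1 : 1 ≤ lam) : χ < 22 * lam ^ 2 := by
  by_contra H
  have H' : 22 * lam ^ 2 ≤ χ := not_lt.1 H
  have hπ := Real.pi_gt_three
  have hπ' := Real.pi_lt_d2
  have hlam := hf.lam_pos
  have hb : π / 6 < lam := by linarith
  have e3 : (3 : ℝ) * (π / 6) = π / 2 := by ring
  obtain ⟨t, ht, hft⟩ := hf.exists_zero_of_picone₁ hχ (u := fun t ↦ Real.cos (3 * t))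
    (u' := fun t ↦ -(3 * Real.sin (3 * t))) (qu := fun _ ↦ -(3 : ℝ) ^ 2) (a := 0) (b := π / 6)
    (hasDerivAt_cos_comp 3) (hasDerivAt_cos'_comp 3) le_rfl (by positivity) hb
    (fun x hx ↦ (Real.cos_pos_of_mem_Ioo ⟨by linarith [hx.1], by linarith [hx.2]⟩).ne')
    (fun x hx ↦ by
      have hx1 : 2 * π * lam * x < 2 * π * lam * (π / 6) := mul_lt_mul_of_pos_left hx.2 (by positivity)
      have hx0 : 0 ≤ 2 * π * lam * x := by have := hx.1; positivity
      have hx2 : (2 * π * lam * x) ^ 2 < (2 * π * lam * (π / 6)) ^ 2 :=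
        pow_lt_pow_left₀ hx1 hx0 two_ne_zero
      have h5 : (2 * π * lam * (π / 6)) ^ 2 = π ^ 4 * lam ^ 2 / 9 := by ring
      have h4 : π ^ 4 * lam ^ 2 < 100 * lam ^ 2 :=
        mul_lt_mul_of_pos_right pi_pow_four_lt (by positivity)
      have hl2 : 0 < lam ^ 2 := by positivity
      nlinarith)
    (Or.inr ⟨rfl, by simp⟩) (by simp only [e3, Real.cos_pi_div_two]) (hf.pos_of_zero ⟨by linarith, hlam⟩).ne'
    (hf.pos_of_zero ⟨by linarith, hb⟩).ne'
  exact (hf.pos_of_zero ⟨by linarith [ht.1], ht.2.trans hb⟩).ne' hft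

/-- `χ₄(λ) < 102λ²` for `λ ≥ 2` (else comparison with `cos kx`, `k ∈ (7, 7.1)` generic, would force
three zeros of `h_{4,λ}` in `(0, 5π/(2k))`). [folklore] -/
theorem eigen_lt_of_four (hf : IsProlateFunction lam 4 f) {χ : ℝ}
    (hχ : ∀ x ∈ Ioo (-lam) lam,
      -(deriv (fun y ↦ (lam ^ 2 - y ^ 2) * deriv f y) x) + (2 * π * lam * x) ^ 2 * f x = χ * f x)
    (h2 : 2 ≤ lam) : χ < 102 * lam ^ 2 := by
  by_contra H
  have H' : 102 * lam ^ 2 ≤ χ := not_lt.1 H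
  have hπ := Real.pi_gt_three
  have hπ' := Real.pi_lt_d2
  have hlam := hf.lam_pos
  set S := {x : ℝ | x ∈ Ioo 0 lam ∧ f x = 0} with hS
  have hSf : S.Finite := hf.zeros_finite.subset fun x hx ↦ ⟨⟨by linarith [hx.1.1], hx.1.2⟩, hx.2⟩
  obtain ⟨k, hk, hgen⟩ := exists_generic_mul hSf ({π / 2, 3 * π / 2, 5 * π / 2} : Finset ℝ)
    (by norm_num : (7 : ℝ) < 7.1)
  have hk0 : 0 < k := by linarith [hk.1]
  set t₀ : ℝ := π / (2 * k) with ht₀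
  set t₁ : ℝ := 3 * π / (2 * k) with ht₁
  set t₂ : ℝ := 5 * π / (2 * k) with ht₂
  have ht₀0 : 0 < t₀ := by positivity
  have h01 : t₀ < t₁ := by
    rw [ht₀, ht₁, div_lt_div_iff_of_pos_right (by positivity)]; linarith
  have h12 : t₁ < t₂ := by
    rw [ht₁, ht₂, div_lt_div_iff_of_pos_right (by positivity)]; linarith
  have ht₂l : t₂ < lam := by
    rw [ht₂, div_lt_iff₀ (by positivity)]; nlinarith [hk.1]
  have ekt₀ : k * t₀ = π / 2 := by rw [ht₀]; field_simp
  have ekt₁ : k * t₁ = 3 * π / 2 := by rw [ht₁]; field_simp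
  have ekt₂ : k * t₂ = 5 * π / 2 := by rw [ht₂]; field_simp
  have hu₀ : Real.cos (k * t₀) = 0 := by rw [ekt₀]; exact Real.cos_pi_div_two
  have hu₁ : Real.cos (k * t₁) = 0 := by
    rw [ekt₁]; exact Real.cos_eq_zero_iff.2 ⟨1, by push_cast; ring⟩
  have hu₂ : Real.cos (k * t₂) = 0 := by
    rw [ekt₂]; exact Real.cos_eq_zero_iff.2 ⟨2, by push_cast; ring⟩
  -- `f ≠ 0` at the `tᵢ` (genericity) and at `0`
  have hgen' : ∀ t ∈ Ioo 0 lam, k * t ∈ ({π / 2, 3 * π / 2, 5 * π / 2} : Finset ℝ) → f t ≠ 0 :=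
    fun t ht hmem hft ↦ hgen t ⟨ht, hft⟩ ht.1.ne' _ hmem rfl
  have hf₀ : f t₀ ≠ 0 := hgen' t₀ ⟨ht₀0, by linarith⟩ (by simp [ekt₀])
  have hf₁ : f t₁ ≠ 0 := hgen' t₁ ⟨by linarith, by linarith⟩ (by simp [ekt₁])
  have hf₂ : f t₂ ≠ 0 := hgen' t₂ ⟨by linarith, ht₂l⟩ (by simp [ekt₂])
  have hf0 : f 0 ≠ 0 := hf.pos_zero.ne'
  -- the gap on `(0, t₂)`
  have hgap : ∀ x ∈ Ioo 0 t₂, (2 * π * lam * x) ^ 2 - χ < lam ^ 2 * (-k ^ 2) := by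
    intro x hx
    have hx1 : k * x < 5 * π / 2 := by
      rw [← ekt₂]; exact mul_lt_mul_of_pos_left hx.2 hk0
    have hx0 : 0 ≤ k * x := by have := hx.1; positivity
    have hA : k * (2 * π * lam * x) < 5 * π ^ 2 * lam := by
      have := mul_lt_mul_of_pos_left hx1 (by positivity : (0 : ℝ) < 2 * π * lam)
      linarith
    have hA' : (k * (2 * π * lam * x)) ^ 2 < (5 * π ^ 2 * lam) ^ 2 :=
      pow_lt_pow_left₀ hA (by have := hx.1; positivity) two_ne_zero
    have hk7 : 49 ≤ k ^ 2 := by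
      have := pow_le_pow_left₀ (by norm_num : (0 : ℝ) ≤ 7) hk.1.le 2
      norm_num at this ⊢
      linarith
    have h49 : 49 * (2 * π * lam * x) ^ 2 ≤ (k * (2 * π * lam * x)) ^ 2 :=
      calc 49 * (2 * π * lam * x) ^ 2 ≤ k ^ 2 * (2 * π * lam * x) ^ 2 :=
            mul_le_mul_of_nonneg_right hk7 (sq_nonneg _)
        _ = (k * (2 * π * lam * x)) ^ 2 := by ring
    have h4 : π ^ 4 * lam ^ 2 < 100 * lam ^ 2 :=
      mul_lt_mul_of_pos_right pi_pow_four_lt (by positivity)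
    have hk2 : k ^ 2 < 7.1 ^ 2 := by nlinarith [hk.1, hk.2]
    have hk2' : lam ^ 2 * k ^ 2 < lam ^ 2 * 7.1 ^ 2 := mul_lt_mul_of_pos_left hk2 (by positivity)
    nlinarith
  have hcd := hasDerivAt_cos_comp k
  have hcd' := hasDerivAt_cos'_comp k
  -- three zeros
  obtain ⟨s₀, hs₀, hfs₀⟩ := hf.exists_zero_of_picone₁ hχ (u := fun t ↦ Real.cos (k * t))
    (u' := fun t ↦ -(k * Real.sin (k * t))) (qu := fun _ ↦ -k ^ 2) (a := 0) (b := t₀)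
    hcd hcd' le_rfl ht₀0 (by linarith)
    (fun x hx ↦ (Real.cos_pos_of_mem_Ioo ⟨by nlinarith [hx.1], by
      rw [← ekt₀]; exact mul_lt_mul_of_pos_left hx.2 hk0⟩).ne')
    (fun x hx ↦ hgap x ⟨hx.1, by linarith [hx.2]⟩)
    (Or.inr ⟨rfl, by simp⟩) hu₀ hf0 hf₀
  obtain ⟨s₁, hs₁, hfs₁⟩ := hf.exists_zero_of_picone₁ hχ (u := fun t ↦ Real.cos (k * t))
    (u' := fun t ↦ -(k * Real.sin (k * t))) (qu := fun _ ↦ -k ^ 2) (a := t₀) (b := t₁)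
    hcd hcd' ht₀0.le h01 (by linarith)
    (fun x hx ↦ (Real.cos_neg_of_pi_div_two_lt_of_lt
      (by rw [← ekt₀]; exact mul_lt_mul_of_pos_left hx.1 hk0)
      (by have := mul_lt_mul_of_pos_left hx.2 hk0; rw [ekt₁] at this; linarith)).ne)
    (fun x hx ↦ hgap x ⟨by linarith [hx.1], by linarith [hx.2]⟩)
    (Or.inl hu₀) hu₁ hf₀ hf₁
  obtain ⟨s₂, hs₂, hfs₂⟩ := hf.exists_zero_of_picone₁ hχ (u := fun t ↦ Real.cos (k * t))
    (u' := fun t ↦ -(k * Real.sin (k * t))) (qu := fun _ ↦ -k ^ 2) (a := t₁) (b := t₂)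
    hcd hcd' (by linarith) h12 ht₂l
    (fun x hx ↦ by
      have h1 : 3 * π / 2 < k * x := by rw [← ekt₁]; exact mul_lt_mul_of_pos_left hx.1 hk0
      have h2 : k * x < 5 * π / 2 := by rw [← ekt₂]; exact mul_lt_mul_of_pos_left hx.2 hk0
      have := Real.cos_pos_of_mem_Ioo (x := k * x - 2 * π) ⟨by linarith, by linarith⟩
      rw [Real.cos_sub_two_pi] at this
      exact this.ne')
    (fun x hx ↦ hgap x ⟨by linarith [hx.1], hx.2⟩)
    (Or.inl hu₁) hu₂ hf₁ hf₂
  exact hf.false_of_three_zeros ⟨hs₀.1, by linarith [hs₀.2]⟩ ⟨by linarith [hs₁.1], by linarith [hs₁.2]⟩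
    ⟨by linarith [hs₂.1], by linarith [hs₂.2]⟩ (by linarith [hs₀.2, hs₁.1])
    (by linarith [hs₁.2, hs₂.1]) hfs₀ hfs₁ hfs₂

/-- `χ₄(λ) > 0`: otherwise the whole of `[0, λ)` is past the turning point and `h_{4,λ}` has no
zeros. [folklore] -/
theorem eigen_pos_of_four (hf : IsProlateFunction lam 4 f) {χ : ℝ}
    (hχ : ∀ x ∈ Ioo (-lam) lam,
      -(deriv (fun y ↦ (lam ^ 2 - y ^ 2) * deriv f y) x) + (2 * π * lam * x) ^ 2 * f x = χ * f x) :
    0 < χ := by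
  obtain ⟨ζ₁, ζ₂, h₁, h12, h₂, hz₁, -, -⟩ := hf.exists_zeros_of_four
  have := hf.sq_lt_eigen_of_zero hχ ⟨h₁.le, by linarith⟩ hz₁
  nlinarith [sq_nonneg (2 * π * lam * ζ₁)]

/-! ### Eigenvalue pinning from above (comparison with `h_n(κx)`, `κ > 1`, and `riccati_upper`) -/

/-- The pointwise gap for the upper comparison (pure algebra). [folklore] -/
theorem upper_gap_aux {x χ κ ε δ lam μ : ℝ} (hl2 : 0 < lam ^ 2) (hκ1 : 1 ≤ κ ^ 2)
    (hκsq' : κ ^ 2 ≤ 1 + 8 * ε) (hμ : 0 ≤ μ) (hδ : 0 ≤ δ) (hεδ : 8 * ε * μ ≤ δ / 2)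
    (H' : (μ + δ) * lam ^ 2 < χ) :
    (2 * π * lam * x) ^ 2 - χ < lam ^ 2 * (κ ^ 2 * (4 * π ^ 2 * (κ * x) ^ 2 - μ)) := by
  have hk4 : (2 * π * lam * x) ^ 2 ≤ κ ^ 2 * κ ^ 2 * (2 * π * lam * x) ^ 2 :=
    le_mul_of_one_le_left (sq_nonneg _) (by nlinarith)
  have h1 : μ * κ ^ 2 ≤ μ + δ / 2 := by nlinarith
  have h1' := mul_le_mul_of_nonneg_right h1 hl2.le
  have h2 : μ * κ ^ 2 * lam ^ 2 < χ := by nlinarith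
  nlinarith

/-- The sign at the truncation point for the upper comparison (pure algebra). [folklore] -/
theorem upper_sign_aux {A B W X κ ε lam : ℝ} (hA : 0 < A) (hl2 : 0 < lam ^ 2) (hX2 : 2 ≤ X)
    (hκsq : 1 + 2 * ε ≤ κ ^ 2) (hXε : 2 * π + 10 ≤ 4 * π * ε * X)
    (hWlt : W < lam ^ 2 * (2 * π * (X + 1) + 1))
    (hlog : B * A * (κ * X) ≤ (-2 * π * (κ * X) ^ 2 + 8) * A ^ 2) :
    lam ^ 2 * κ * (B * A) + A ^ 2 * W < 0 := by
  have hπ0 := Real.pi_pos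
  have hX0 : 0 < X := by linarith
  have hAl : 0 < A ^ 2 * lam ^ 2 := by positivity
  have p1 : X * (A ^ 2 * W) < X * (A ^ 2 * (lam ^ 2 * (2 * π * (X + 1) + 1))) :=
    mul_lt_mul_of_pos_left (mul_lt_mul_of_pos_left hWlt (by positivity)) hX0
  have p2 : lam ^ 2 * (B * A * (κ * X)) ≤ lam ^ 2 * ((-2 * π * (κ * X) ^ 2 + 8) * A ^ 2) :=
    mul_le_mul_of_nonneg_left hlog hl2.le
  have q3 : 2 * π * (A ^ 2 * lam ^ 2) * ((1 + 2 * ε) * X ^ 2)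
      ≤ 2 * π * (A ^ 2 * lam ^ 2) * (κ ^ 2 * X ^ 2) :=
    mul_le_mul_of_nonneg_left (mul_le_mul_of_nonneg_right hκsq (sq_nonneg _)) (by positivity)
  have q4 : A ^ 2 * lam ^ 2 * X * (2 * π + 10) ≤ A ^ 2 * lam ^ 2 * X * (4 * π * ε * X) :=
    mul_le_mul_of_nonneg_left hXε (by positivity)
  have q5 : 2 * (A ^ 2 * lam ^ 2) ≤ X * (A ^ 2 * lam ^ 2) :=
    mul_le_mul_of_nonneg_right hX2 hAl.le
  have hneg : X * (lam ^ 2 * κ * (B * A) + A ^ 2 * W) < 0 := by linarith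
  exact neg_of_mul_neg_right hneg hX0.le

/-- **Upper pinning, `n = 4`**: `χ₄(λ) ≤ (18π + δ)λ²` for `λ ≥ Λ(δ)`. [cite: SlepianPollak1961,
§III (`χ_n(c)/c → 2n+1`); folklore proof by Sturm–Picone comparison] -/
theorem eigen_upper_four {δ : ℝ} (hδ : 0 < δ) : ∃ Λ : ℝ, ∀ lam : ℝ, Λ ≤ lam →
    ∀ f : ℝ → ℝ, ∀ χ : ℝ, IsProlateFunction lam 4 f →
    (∀ x ∈ Ioo (-lam) lam,
      -(deriv (fun y ↦ (lam ^ 2 - y ^ 2) * deriv f y) x) + (2 * π * lam * x) ^ 2 * f x = χ * f x) →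
    χ ≤ (18 * π + δ) * lam ^ 2 := by
  have hπ := Real.pi_gt_three
  have hπ0 := Real.pi_pos
  set ε : ℝ := min δ 1 / (16 * (18 * π)) with hε
  have hm0 : 0 < min δ 1 := lt_min hδ one_pos
  have hε0 : 0 < ε := by rw [hε]; positivity
  have hε1 : ε ≤ 1 := by
    rw [hε, div_le_one (by positivity)]
    linarith [min_le_right δ 1]
  have hεδ : 8 * ε * (18 * π) ≤ δ / 2 := by
    have : ε * (16 * (18 * π)) = min δ 1 := by rw [hε]; field_simp
    linarith [min_le_left δ 1]
  set X : ℝ := (2 * π + 10) / (4 * π * ε) + 2 with hX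
  have hX2 : 2 ≤ X := by rw [hX]; linarith [(by positivity : 0 ≤ (2 * π + 10) / (4 * π * ε))]
  have hX0 : 0 < X := by linarith
  have hXε : 2 * π + 10 ≤ 4 * π * ε * X := by
    have : 4 * π * ε * X = (2 * π + 10) + 8 * π * ε := by rw [hX]; field_simp; ring
    rw [this]; linarith [(by positivity : 0 ≤ 8 * π * ε)]
  refine ⟨X + 2, fun lam hlam f χ hf hχ ↦ ?_⟩
  by_contra H
  have H' : (18 * π + δ) * lam ^ 2 < χ := not_le.1 H
  have hlam0 := hf.lam_pos
  have hl2 : 0 < lam ^ 2 := by positivity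
  have h102 := hf.eigen_lt_of_four hχ (by linarith)
  have hχ0 : 0 < χ := lt_trans (by positivity) H'
  have hχX : χ ≤ (2 * π * lam * X) ^ 2 := by
    have h0 : 12 ≤ 2 * π * X := by nlinarith
    have h1 : (144 : ℝ) ≤ (2 * π * X) ^ 2 := by nlinarith
    have e : (2 * π * lam * X) ^ 2 = (2 * π * X) ^ 2 * lam ^ 2 := by ring
    have h2 := mul_le_mul_of_nonneg_right h1 hl2.le
    rw [e]
    linarith
  -- generic `κ ∈ (1 + ε, 1 + 2ε)`
  have hSf : {x : ℝ | x ∈ Ioo 0 lam ∧ f x = 0}.Finite :=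
    hf.zeros_finite.subset fun x hx ↦ ⟨⟨by linarith [hx.1.1], hx.1.2⟩, hx.2⟩
  obtain ⟨κ, hκ, hgen⟩ := exists_generic_mul hSf ({hermiteZero₁, hermiteZero₂} : Finset ℝ)
    (show 1 + ε < 1 + 2 * ε by linarith)
  have hκ1 : 1 < κ := by linarith [hκ.1]
  have hκ0 : 0 < κ := by linarith
  have hκsq : 1 + 2 * ε ≤ κ ^ 2 := by nlinarith [hκ.1]
  have hκsq' : κ ^ 2 ≤ 1 + 8 * ε := by nlinarith [hκ.2]
  have hgen' : ∀ t ∈ Ioo 0 lam, κ * t ∈ ({hermiteZero₁, hermiteZero₂} : Finset ℝ) → f t ≠ 0 :=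
    fun t ht hmem hft ↦ hgen t ⟨ht, hft⟩ ht.1.ne' _ hmem rfl
  -- the gap, everywhere
  have hgap : ∀ x : ℝ, (2 * π * lam * x) ^ 2 - χ
      < lam ^ 2 * (κ ^ 2 * (4 * π ^ 2 * (κ * x) ^ 2 - 18 * π)) :=
    fun x ↦ upper_gap_aux hl2 (by linarith) hκsq' (by positivity) hδ.le hεδ H'
  have y1pos := hermiteZero₁_pos
  have y12 := hermiteZero₁_lt_hermiteZero₂
  have y2one := hermiteZero₂_lt_one
  obtain ⟨a₁, ha₁⟩ : ∃ a₁ : ℝ, a₁ = hermiteZero₁ / κ := ⟨_, rfl⟩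
  obtain ⟨a₂, ha₂⟩ : ∃ a₂ : ℝ, a₂ = hermiteZero₂ / κ := ⟨_, rfl⟩
  have eκa₁ : κ * a₁ = hermiteZero₁ := by rw [ha₁]; field_simp
  have eκa₂ : κ * a₂ = hermiteZero₂ := by rw [ha₂]; field_simp
  have ha₁0 : 0 < a₁ := by rw [ha₁]; positivity
  have ha12 : a₁ < a₂ := by rw [ha₁, ha₂]; exact div_lt_div_of_pos_right y12 hκ0
  have ha₂1 : a₂ < 1 := by rw [ha₂, div_lt_one hκ0]; linarith
  have ha₂X : a₂ < X := by linarith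
  have hXl : X < lam := by linarith
  have hua₁ : hermiteH4 (κ * a₁) = 0 := by rw [eκa₁]; exact hermiteH4_hermiteZero₁
  have hua₂ : hermiteH4 (κ * a₂) = 0 := by rw [eκa₂]; exact hermiteH4_hermiteZero₂
  have hfa₁ : f a₁ ≠ 0 := hgen' a₁ ⟨ha₁0, by linarith⟩ (by simp [eκa₁])
  have hfa₂ : f a₂ ≠ 0 := hgen' a₂ ⟨by linarith, by linarith⟩ (by simp [eκa₂])
  have hf0 : f 0 ≠ 0 := hf.pos_zero.ne'
  have hu := hasDerivAt_hermiteH4_comp κ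
  have hu' := hasDerivAt_hermiteH4'_comp κ
  -- `u ≠ 0` away from `a₁, a₂`
  have hune : ∀ x, 0 < x → x ≠ a₁ → x ≠ a₂ → hermiteH4 (κ * x) ≠ 0 := by
    intro x hx h1 h2
    refine hermiteH4_ne_zero (by positivity) ?_ ?_
    · intro h; rw [← eκa₁] at h; exact h1 (mul_left_cancel₀ hκ0.ne' h)
    · intro h; rw [← eκa₂] at h; exact h2 (mul_left_cancel₀ hκ0.ne' h)
  -- zeros in `(0, a₁)` and `(a₁, a₂)`
  obtain ⟨s₁, hs₁, hfs₁⟩ := hf.exists_zero_of_picone₁ hχ (u := fun t ↦ hermiteH4 (κ * t))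
    (u' := fun t ↦ κ * hermiteH4' (κ * t))
    (qu := fun t ↦ κ ^ 2 * (4 * π ^ 2 * (κ * t) ^ 2 - 18 * π)) (a := 0) (b := a₁)
    hu hu' le_rfl ha₁0 (by linarith)
    (fun x hx ↦ hune x hx.1 hx.2.ne (by linarith [hx.2]))
    (fun x _ ↦ hgap x) (Or.inr ⟨rfl, by simp [hermiteH4'_zero]⟩) hua₁ hf0 hfa₁
  obtain ⟨s₂, hs₂, hfs₂⟩ := hf.exists_zero_of_picone₁ hχ (u := fun t ↦ hermiteH4 (κ * t))
    (u' := fun t ↦ κ * hermiteH4' (κ * t))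
    (qu := fun t ↦ κ ^ 2 * (4 * π ^ 2 * (κ * t) ^ 2 - 18 * π)) (a := a₁) (b := a₂)
    hu hu' ha₁0.le ha12 (by linarith)
    (fun x hx ↦ hune x (ha₁0.trans hx.1) hx.1.ne' hx.2.ne)
    (fun x _ ↦ hgap x) (Or.inl hua₁) hua₂ hfa₁ hfa₂
  -- a third zero in `(a₂, X]`
  have h3 : ∃ s ∈ Ioc a₂ X, f s = 0 := by
    by_contra hcon
    push Not at hcon
    have hfne : ∀ x ∈ Icc a₂ X, f x ≠ 0 := by
      intro x hx
      rcases eq_or_lt_of_le hx.1 with h | h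
      · rw [← h]; exact hfa₂
      · exact hcon x ⟨h, hx.2⟩
    have hlt := hf.picone₁_lt hχ (u := fun t ↦ hermiteH4 (κ * t))
      (u' := fun t ↦ κ * hermiteH4' (κ * t))
      (qu := fun t ↦ κ ^ 2 * (4 * π ^ 2 * (κ * t) ^ 2 - 18 * π)) (a := a₂) (b := X)
      hu hu' (by linarith) ha₂X hXl hfne
      (fun x hx ↦ hune x ((ha₁0.trans ha12).trans hx.1) (by linarith [hx.1]) hx.1.ne')
      (fun x _ ↦ hgap x)
    have hlt' : 0 < lam ^ 2 * (hermiteH4 (κ * X) * (κ * hermiteH4' (κ * X)))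
        - hermiteH4 (κ * X) ^ 2 * ((lam ^ 2 - X ^ 2) * deriv f X) / f X := by
      simpa [hua₂] using hlt
    -- the sign at `X`
    have hfX : f X ≠ 0 := hfne X (right_mem_Icc.2 ha₂X.le)
    have hκX : 1 ≤ κ * X := by
      have := mul_le_mul hκ1.le hX2 (by norm_num) hκ0.le
      linarith
    have hApos : 0 < hermiteH4 (κ * X) := hermiteH4_pos_of_one_le hκX
    have hWlt : -((lam ^ 2 - X ^ 2) * deriv f X) / f X < lam ^ 2 * (2 * π * (X + 1) + 1) :=
      hf.riccati_upper hχ hχ0.le (by linarith) (by linarith) hχX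
    have hlog := hermiteH4'_mul_le hκX
    have eΦ : lam ^ 2 * (hermiteH4 (κ * X) * (κ * hermiteH4' (κ * X)))
        - hermiteH4 (κ * X) ^ 2 * ((lam ^ 2 - X ^ 2) * deriv f X) / f X
        = lam ^ 2 * κ * (hermiteH4' (κ * X) * hermiteH4 (κ * X))
          + hermiteH4 (κ * X) ^ 2 * (-((lam ^ 2 - X ^ 2) * deriv f X) / f X) := by
      field_simp; ring
    rw [eΦ] at hlt'
    have hneg := upper_sign_aux hApos hl2 hX2 hκsq hXε hWlt hlog
    linarith
  obtain ⟨s₃, hs₃, hfs₃⟩ := h3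
  exact hf.false_of_three_zeros ⟨hs₁.1, by linarith [hs₁.2]⟩ ⟨by linarith [hs₂.1], by linarith [hs₂.2]⟩
    ⟨by linarith [hs₃.1], by linarith [hs₃.2]⟩ (by linarith [hs₁.2, hs₂.1])
    (by linarith [hs₂.2, hs₃.1]) hfs₁ hfs₂ hfs₃

/-- **Upper pinning, `n = 0`**: `χ₀(λ) ≤ (2π + δ)λ²` for `λ ≥ Λ(δ)`. [cite: SlepianPollak1961,
§III; folklore] -/
theorem eigen_upper_zero {δ : ℝ} (hδ : 0 < δ) : ∃ Λ : ℝ, ∀ lam : ℝ, Λ ≤ lam →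
    ∀ f : ℝ → ℝ, ∀ χ : ℝ, IsProlateFunction lam 0 f →
    (∀ x ∈ Ioo (-lam) lam,
      -(deriv (fun y ↦ (lam ^ 2 - y ^ 2) * deriv f y) x) + (2 * π * lam * x) ^ 2 * f x = χ * f x) →
    χ ≤ (2 * π + δ) * lam ^ 2 := by
  have hπ := Real.pi_gt_three
  have hπ0 := Real.pi_pos
  set ε : ℝ := min δ 1 / (16 * (2 * π)) with hε
  have hm0 : 0 < min δ 1 := lt_min hδ one_pos
  have hε0 : 0 < ε := by rw [hε]; positivity
  have hε1 : ε ≤ 1 := by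
    rw [hε, div_le_one (by positivity)]
    linarith [min_le_right δ 1]
  have hεδ : 8 * ε * (2 * π) ≤ δ / 2 := by
    have : ε * (16 * (2 * π)) = min δ 1 := by rw [hε]; field_simp
    linarith [min_le_left δ 1]
  set X : ℝ := (2 * π + 10) / (4 * π * ε) + 2 with hX
  have hX2 : 2 ≤ X := by rw [hX]; linarith [(by positivity : 0 ≤ (2 * π + 10) / (4 * π * ε))]
  have hX0 : 0 < X := by linarith
  have hXε : 2 * π + 10 ≤ 4 * π * ε * X := by
    have : 4 * π * ε * X = (2 * π + 10) + 8 * π * ε := by rw [hX]; field_simp; ring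
    rw [this]; linarith [(by positivity : 0 ≤ 8 * π * ε)]
  refine ⟨X + 2, fun lam hlam f χ hf hχ ↦ ?_⟩
  by_contra H
  have H' : (2 * π + δ) * lam ^ 2 < χ := not_le.1 H
  have hlam0 := hf.lam_pos
  have hl2 : 0 < lam ^ 2 := by positivity
  have h22 := hf.eigen_lt_of_zero hχ (by linarith)
  have hχ0 : 0 < χ := lt_trans (by positivity) H'
  have hχX : χ ≤ (2 * π * lam * X) ^ 2 := by
    have h0 : 12 ≤ 2 * π * X := by nlinarith
    have h1 : (144 : ℝ) ≤ (2 * π * X) ^ 2 := by nlinarith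
    have e : (2 * π * lam * X) ^ 2 = (2 * π * X) ^ 2 * lam ^ 2 := by ring
    have h2 := mul_le_mul_of_nonneg_right h1 hl2.le
    rw [e]
    linarith
  obtain ⟨κ, hκ, -⟩ := exists_generic_mul Set.finite_empty (∅ : Finset ℝ)
    (show 1 + ε < 1 + 2 * ε by linarith)
  have hκ1 : 1 < κ := by linarith [hκ.1]
  have hκ0 : 0 < κ := by linarith
  have hκsq : 1 + 2 * ε ≤ κ ^ 2 := by nlinarith [hκ.1]
  have hκsq' : κ ^ 2 ≤ 1 + 8 * ε := by nlinarith [hκ.2]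
  have hgap : ∀ x : ℝ, (2 * π * lam * x) ^ 2 - χ
      < lam ^ 2 * (κ ^ 2 * (4 * π ^ 2 * (κ * x) ^ 2 - 2 * π)) :=
    fun x ↦ upper_gap_aux hl2 (by linarith) hκsq' (by positivity) hδ.le hεδ H'
  have hXl : X < lam := by linarith
  have hu := hasDerivAt_hermiteH0_comp κ
  have hu' := hasDerivAt_hermiteH0'_comp κ
  have hlt := hf.picone₁_lt hχ (u := fun t ↦ hermiteH0 (κ * t))
    (u' := fun t ↦ κ * hermiteH0' (κ * t))
    (qu := fun t ↦ κ ^ 2 * (4 * π ^ 2 * (κ * t) ^ 2 - 2 * π)) (a := 0) (b := X)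
    hu hu' le_rfl hX0 hXl (fun x hx ↦ (hf.pos_of_zero ⟨by linarith [hx.1], by linarith [hx.2]⟩).ne')
    (fun x _ ↦ (hermiteH0_pos _).ne') (fun x _ ↦ hgap x)
  have hlt' : 0 < lam ^ 2 * (hermiteH0 (κ * X) * (κ * hermiteH0' (κ * X)))
      - hermiteH0 (κ * X) ^ 2 * ((lam ^ 2 - X ^ 2) * deriv f X) / f X := by
    simpa [hermiteH0'_zero, hf.deriv_zero] using hlt
  have hfX : f X ≠ 0 := (hf.pos_of_zero ⟨by linarith, hXl⟩).ne'
  have hApos : 0 < hermiteH0 (κ * X) := hermiteH0_pos _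
  have hWlt : -((lam ^ 2 - X ^ 2) * deriv f X) / f X < lam ^ 2 * (2 * π * (X + 1) + 1) :=
    hf.riccati_upper hχ hχ0.le (by linarith) (by linarith) hχX
  have eΦ : lam ^ 2 * (hermiteH0 (κ * X) * (κ * hermiteH0' (κ * X)))
      - hermiteH0 (κ * X) ^ 2 * ((lam ^ 2 - X ^ 2) * deriv f X) / f X
      = hermiteH0 (κ * X) ^ 2 * (-((lam ^ 2 - X ^ 2) * deriv f X) / f X
        - 2 * π * κ ^ 2 * X * lam ^ 2) := by
    rw [hermiteH0'_eq]; field_simp; ring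
  rw [eΦ] at hlt'
  have hA2 : 0 < hermiteH0 (κ * X) ^ 2 := by positivity
  have hW2 : -((lam ^ 2 - X ^ 2) * deriv f X) / f X < 2 * π * κ ^ 2 * X * lam ^ 2 := by
    have q3 : 2 * π * X * lam ^ 2 * (1 + 2 * ε) ≤ 2 * π * X * lam ^ 2 * κ ^ 2 :=
      mul_le_mul_of_nonneg_left hκsq (by positivity)
    have q4 : lam ^ 2 * (2 * π + 10) ≤ lam ^ 2 * (4 * π * ε * X) :=
      mul_le_mul_of_nonneg_left hXε hl2.le
    linarith
  have := mul_lt_mul_of_pos_left (sub_neg.2 hW2) hA2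
  linarith

/-! ### Eigenvalue pinning from below (comparison with `h_n(κx)`, `κ < 1`, and `riccati_lower`) -/

/-- The pointwise gap for the lower comparison (pure algebra). [folklore] -/
theorem lower_gap_aux {x χ κ ε δ lam μ X : ℝ} (hμ : 0 ≤ μ) (hε : 0 ≤ ε) (hκ1 : κ ^ 2 ≤ 1)
    (hκsq : 1 - 4 * ε ≤ κ ^ 2) (hεδ : 16 * ε * μ ≤ δ) (hX0 : 0 ≤ X ^ 2) (hXl : X ^ 2 ≤ lam ^ 2)
    (hbig : X ^ 2 * μ < 3 * δ / 4 * lam ^ 2) (H' : χ < (μ - δ) * lam ^ 2) :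
    (lam ^ 2 - X ^ 2) * (κ ^ 2 * (4 * π ^ 2 * (κ * x) ^ 2 - μ)) < (2 * π * lam * x) ^ 2 - χ := by
  have hk0 : 0 ≤ κ ^ 2 := sq_nonneg κ
  have hk4 : κ ^ 2 * κ ^ 2 * (4 * π ^ 2 * x ^ 2) ≤ 4 * π ^ 2 * x ^ 2 :=
    mul_le_of_le_one_left (by positivity) (by nlinarith)
  have t1 : (lam ^ 2 - X ^ 2) * (κ ^ 2 * κ ^ 2 * (4 * π ^ 2 * x ^ 2)) ≤ lam ^ 2 * (4 * π ^ 2 * x ^ 2) :=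
    mul_le_mul (by linarith) hk4 (by positivity) (by positivity)
  have t2 : (lam ^ 2 - X ^ 2) * ((1 - 4 * ε) * μ) ≤ (lam ^ 2 - X ^ 2) * (κ ^ 2 * μ) :=
    mul_le_mul_of_nonneg_left (mul_le_mul_of_nonneg_right hκsq hμ) (by linarith)
  have t3 : ε * μ * lam ^ 2 * 16 ≤ δ * lam ^ 2 := by nlinarith
  have t4 : 0 ≤ ε * X ^ 2 * μ := by positivity
  nlinarith

/-- The sign at the truncation point for the lower comparison (pure algebra). [folklore] -/
theorem lower_sign_aux {A B W c κ θ X lam : ℝ} (hA : 0 < A) (hX : 0 < X) (hκ : 0 < κ)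
    (hc0 : 0 ≤ c) (hcl : c ≤ lam ^ 2) (hθκ : κ ^ 2 < θ) (hl2 : 0 < lam ^ 2)
    (hW : lam ^ 2 * (2 * π * θ * X) ≤ W) (hlog : -(2 * π * (κ * X)) * A ^ 2 ≤ B * A) :
    0 < W + c * κ * B / A := by
  have hπ0 := Real.pi_pos
  have hBA : -(2 * π * (κ * X)) ≤ B / A := by
    rw [le_div_iff₀ hA]
    rw [sq, ← mul_assoc] at hlog
    exact le_of_mul_le_mul_right hlog hA
  have h1 : c * κ * (-(2 * π * (κ * X))) ≤ c * κ * (B / A) :=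
    mul_le_mul_of_nonneg_left hBA (by positivity)
  have h2 : c * (2 * π * κ ^ 2 * X) ≤ lam ^ 2 * (2 * π * κ ^ 2 * X) :=
    mul_le_mul_of_nonneg_right hcl (by positivity)
  have h3 : lam ^ 2 * (2 * π * X) * κ ^ 2 < lam ^ 2 * (2 * π * X) * θ :=
    mul_lt_mul_of_pos_left hθκ (by positivity)
  have e : c * κ * B / A = c * κ * (B / A) := by ring
  rw [e]
  linarith

set_option maxHeartbeats 800000 in
/-- **Lower pinning, `n = 4`**: `(18π − δ)λ² ≤ χ₄(λ)` for `λ ≥ Λ(δ)`. [cite: SlepianPollak1961,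
§III; folklore proof by Sturm–Picone comparison] -/
theorem eigen_lower_four {δ : ℝ} (hδ : 0 < δ) : ∃ Λ : ℝ, ∀ lam : ℝ, Λ ≤ lam →
    ∀ f : ℝ → ℝ, ∀ χ : ℝ, IsProlateFunction lam 4 f →
    (∀ x ∈ Ioo (-lam) lam,
      -(deriv (fun y ↦ (lam ^ 2 - y ^ 2) * deriv f y) x) + (2 * π * lam * x) ^ 2 * f x = χ * f x) →
    (18 * π - δ) * lam ^ 2 ≤ χ := by
  have hπ := Real.pi_gt_three
  have hπ' := Real.pi_lt_d2
  have hπ0 := Real.pi_pos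
  set μ : ℝ := 18 * π with hμ
  have hμ0 : 0 < μ := by positivity
  set ε : ℝ := min δ μ / (16 * μ) with hε
  have hm0 : 0 < min δ μ := lt_min hδ hμ0
  have hε0 : 0 < ε := by rw [hε]; positivity
  have hε16 : 16 * ε ≤ 1 := by
    have : 16 * ε = min δ μ / μ := by rw [hε]; field_simp
    rw [this, div_le_one hμ0]; exact min_le_right δ μ
  have hεδ : 16 * ε * μ ≤ δ := by
    have : 16 * ε * μ = min δ μ := by rw [hε]; field_simp
    rw [this]; exact min_le_left δ μ
  set θ : ℝ := 1 - ε / 2 with hθ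
  have hθ0 : 0 < θ := by rw [hθ]; linarith
  have hθ1 : θ ≤ 1 := by rw [hθ]; linarith
  set X : ℝ := (2 * π + μ) / (2 * π ^ 2 * ε) + 2 with hX
  have hX2 : 2 ≤ X := by rw [hX]; linarith [(by positivity : 0 ≤ (2 * π + μ) / (2 * π ^ 2 * ε))]
  have hX0 : 0 < X := by linarith
  have hXε : 2 * π + μ ≤ 2 * π ^ 2 * ε * X := by
    have : 2 * π ^ 2 * ε * X = (2 * π + μ) + 4 * π ^ 2 * ε := by rw [hX]; field_simp; ring
    rw [this]; linarith [(by positivity : 0 ≤ 4 * π ^ 2 * ε)]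
  refine ⟨2 * (X + 1) / ε + X * (1 + 4 * μ / (3 * δ)) + 2, fun lam hlam f χ hf hχ ↦ ?_⟩
  by_contra H
  have H' : χ < (μ - δ) * lam ^ 2 := not_le.1 H
  have hlam0 := hf.lam_pos
  have hl2 : 0 < lam ^ 2 := by positivity
  have hbig' : 0 ≤ X * (1 + 4 * μ / (3 * δ)) := by positivity
  have hΛ1 : 2 * (X + 1) / ε ≤ lam := by linarith
  have hΛ2 : X * (1 + 4 * μ / (3 * δ)) ≤ lam := by
    linarith [(by positivity : 0 ≤ 2 * (X + 1) / ε)]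
  have hXl : X + 1 < lam := by
    have : X + 1 ≤ 2 * (X + 1) / ε := by
      rw [le_div_iff₀ hε0]; nlinarith
    linarith
  have hχμ : χ < μ * lam ^ 2 := by have := mul_pos hδ hl2; linarith
  have hχX : χ ≤ (2 * π * lam * X) ^ 2 := by
    have h0 : 12 ≤ 2 * π * X := by
      have := mul_le_mul hπ.le hX2 (by norm_num) hπ0.le; linarith
    have h1 : (144 : ℝ) ≤ (2 * π * X) ^ 2 := by
      have := pow_le_pow_left₀ (by norm_num) h0 2; linarith
    have e : (2 * π * lam * X) ^ 2 = (2 * π * X) ^ 2 * lam ^ 2 := by ring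
    have h2 := mul_le_mul_of_nonneg_right h1 hl2.le
    have h3 : μ * lam ^ 2 ≤ 144 * lam ^ 2 := mul_le_mul_of_nonneg_right (by rw [hμ]; linarith) hl2.le
    rw [e]
    linarith
  -- hypotheses of `riccati_lower`
  have hlamp : θ * lam ^ 2 ≤ lam ^ 2 - (X + 1) ^ 2 := by
    have h1 : 2 * (X + 1) ≤ ε * lam := by
      have := hΛ1; rw [div_le_iff₀ hε0] at this; linarith
    have h2 : 2 * (X + 1) * lam ≤ ε * lam * lam := mul_le_mul_of_nonneg_right h1 hlam0.le
    have h3 : (X + 1) ^ 2 ≤ (X + 1) * lam := by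
      rw [sq]; exact mul_le_mul_of_nonneg_left hXl.le (by linarith)
    rw [hθ]; linarith
  have hm : 2 * π * θ * X ≤ 4 * π ^ 2 * X ^ 2 * (1 - θ ^ 2 / θ) - χ / lam ^ 2 := by
    have e1 : θ ^ 2 / θ = θ := by rw [sq, mul_div_assoc, div_self hθ0.ne', mul_one]
    have h1 : χ / lam ^ 2 < μ := (div_lt_iff₀ hl2).2 (by linarith)
    have h2 : 2 * π * θ * X ≤ 2 * π * 1 * X :=
      mul_le_mul_of_nonneg_right (mul_le_mul_of_nonneg_left hθ1 (by positivity)) hX0.le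
    have h3 : (2 * π + μ) * X ≤ 2 * π ^ 2 * ε * X * X := mul_le_mul_of_nonneg_right hXε hX0.le
    have h4 : μ ≤ μ * X := le_mul_of_one_le_right hμ0.le (by linarith)
    have h5 : 4 * π ^ 2 * X ^ 2 * (1 - θ) = 2 * π ^ 2 * ε * X * X := by rw [hθ]; ring
    rw [e1]
    linarith
  have hW := hf.riccati_lower hχ (X := X) (θ := θ) (p₀ := θ) hX0.le hθ0 hθ0 hlamp hχX hm
  -- the zeros of `f`
  obtain ⟨ζ₁, ζ₂, hζ₁0, hζ12, hζ₂l, hz₁, hz₂, huniq⟩ := hf.exists_zeros_of_four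
  have hζX : ζ₂ < 2 := by
    have := hf.sq_lt_eigen_of_zero hχ ⟨by linarith, hζ₂l⟩ hz₂
    by_contra hcon
    push Not at hcon
    have h1 : (2 * π * lam * 2) ^ 2 ≤ (2 * π * lam * ζ₂) ^ 2 :=
      pow_le_pow_left₀ (by positivity) (mul_le_mul_of_nonneg_left hcon (by positivity)) 2
    have h2 : 18 * (π * lam ^ 2) < 16 * π * (π * lam ^ 2) :=
      mul_lt_mul_of_pos_right (by linarith) (by positivity)
    rw [hμ] at hχμ
    linarith
  have hfne : ∀ t ∈ Ioo 0 lam, t ≠ ζ₁ → t ≠ ζ₂ → f t ≠ 0 := by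
    intro t ht h1 h2 hft
    rcases huniq t ht hft with h | h
    exacts [h1 h, h2 h]
  -- generic `κ ∈ (1 − 2ε, 1 − ε)`
  have hSf : {x : ℝ | x ∈ Ioo 0 lam ∧ f x = 0}.Finite :=
    hf.zeros_finite.subset fun x hx ↦ ⟨⟨by linarith [hx.1.1], hx.1.2⟩, hx.2⟩
  obtain ⟨κ, hκ, hgen⟩ := exists_generic_mul hSf ({hermiteZero₁, hermiteZero₂} : Finset ℝ)
    (show 1 - 2 * ε < 1 - ε by linarith)
  have hκ0 : 0 < κ := by linarith [hκ.1]
  have hκ1 : κ ^ 2 ≤ 1 := pow_le_one₀ hκ0.le (by linarith [hκ.2])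
  have hκsq : 1 - 4 * ε ≤ κ ^ 2 := by
    have := pow_le_pow_left₀ (by linarith : 0 ≤ 1 - 2 * ε) hκ.1.le 2
    linarith [sq_nonneg ε]
  have hθκ : κ ^ 2 < θ := by
    have h1 := pow_lt_pow_left₀ hκ.2 hκ0.le two_ne_zero
    have h2 : ε * ε ≤ ε * (1 / 16) := mul_le_mul_of_nonneg_left (by linarith) hε0.le
    rw [hθ]; linarith
  have hvne : ∀ t, 0 < t → t < lam → f t = 0 → hermiteH4 (κ * t) ≠ 0 := by
    intro t ht htl hft
    refine hermiteH4_ne_zero (by positivity) ?_ ?_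
    · exact hgen t ⟨⟨ht, htl⟩, hft⟩ ht.ne' _ (by simp)
    · exact hgen t ⟨⟨ht, htl⟩, hft⟩ ht.ne' _ (by simp)
  have hv₁ := hvne ζ₁ hζ₁0 (by linarith) hz₁
  have hv₂ := hvne ζ₂ (by linarith) hζ₂l hz₂
  have hv0 : hermiteH4 (κ * 0) ≠ 0 := by rw [mul_zero]; exact hermiteH4_zero_pos.ne'
  have hκX : 1 ≤ κ * X := by
    have h78 : 7 / 8 ≤ κ := by linarith [hκ.1]
    have := mul_le_mul h78 hX2 (by norm_num) hκ0.le
    linarith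
  have hvXpos : 0 < hermiteH4 (κ * X) := hermiteH4_pos_of_one_le hκX
  -- the gap on `(0, X)`
  have hbig : X ^ 2 * μ < 3 * δ / 4 * lam ^ 2 := by
    have h1 : X ^ 2 * (1 + 4 * μ / (3 * δ)) ^ 2 ≤ lam ^ 2 := by
      rw [← mul_pow]; exact pow_le_pow_left₀ hbig' hΛ2 2
    have h2 : X ^ 2 * μ < 3 * δ / 4 * (X ^ 2 * (1 + 4 * μ / (3 * δ)) ^ 2) := by
      have e : 3 * δ / 4 * (X ^ 2 * (1 + 4 * μ / (3 * δ)) ^ 2)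
          = X ^ 2 * μ + X ^ 2 * (3 * δ / 4 + μ + 4 * μ ^ 2 / (3 * δ)) := by
        field_simp; ring
      rw [e]
      have : 0 < X ^ 2 * (3 * δ / 4 + μ + 4 * μ ^ 2 / (3 * δ)) := by positivity
      linarith
    have h3 := mul_le_mul_of_nonneg_left h1 (by positivity : 0 ≤ 3 * δ / 4)
    linarith
  have hX2l : X ^ 2 ≤ lam ^ 2 := pow_le_pow_left₀ hX0.le (by linarith) 2
  have hgap : ∀ x : ℝ, (lam ^ 2 - X ^ 2) * (κ ^ 2 * (4 * π ^ 2 * (κ * x) ^ 2 - 18 * π))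
      < (2 * π * lam * x) ^ 2 - χ :=
    fun x ↦ lower_gap_aux hμ0.le hε0.le hκ1 hκsq hεδ (sq_nonneg X) hX2l hbig H'
  have hc0 : 0 ≤ lam ^ 2 - X ^ 2 := sub_nonneg.2 hX2l
  have hv := hasDerivAt_hermiteH4_comp κ
  have hv' := hasDerivAt_hermiteH4'_comp κ
  -- zeros of `v` in `(0, ζ₁)` and `(ζ₁, ζ₂)`
  obtain ⟨r₁, hr₁, hvr₁⟩ := hf.exists_zero_of_picone₂ hχ (v := fun t ↦ hermiteH4 (κ * t))
    (v' := fun t ↦ κ * hermiteH4' (κ * t))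
    (qv := fun t ↦ κ ^ 2 * (4 * π ^ 2 * (κ * t) ^ 2 - 18 * π)) (c := lam ^ 2 - X ^ 2)
    (a := 0) (b := ζ₁) hv hv' hc0 le_rfl hζ₁0 (by linarith)
    (by have := pow_le_pow_left₀ hζ₁0.le (show ζ₁ ≤ X by linarith) 2; linarith)
    (fun x hx ↦ hfne x ⟨hx.1, by linarith [hx.2]⟩ hx.2.ne (show x < ζ₂ by linarith [hx.2]).ne)
    (fun x _ ↦ hgap x) (Or.inr ⟨rfl, by simp [hermiteH4'_zero]⟩) hz₁ hv0 hv₁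
  obtain ⟨r₂, hr₂, hvr₂⟩ := hf.exists_zero_of_picone₂ hχ (v := fun t ↦ hermiteH4 (κ * t))
    (v' := fun t ↦ κ * hermiteH4' (κ * t))
    (qv := fun t ↦ κ ^ 2 * (4 * π ^ 2 * (κ * t) ^ 2 - 18 * π)) (c := lam ^ 2 - X ^ 2)
    (a := ζ₁) (b := ζ₂) hv hv' hc0 hζ₁0.le hζ12 hζ₂l
    (by have := pow_le_pow_left₀ (hζ₁0.le.trans hζ12.le) (show ζ₂ ≤ X by linarith) 2; linarith)
    (fun x hx ↦ hfne x ⟨by linarith [hx.1], by linarith [hx.2]⟩ hx.1.ne' hx.2.ne)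
    (fun x _ ↦ hgap x) (Or.inl hz₁) hz₂ hv₁ hv₂
  -- a third zero of `v` in `(ζ₂, X)`
  have h3 : ∃ r ∈ Ioo ζ₂ X, hermiteH4 (κ * r) = 0 := by
    by_contra hcon
    push Not at hcon
    have hvne' : ∀ x ∈ Icc ζ₂ X, hermiteH4 (κ * x) ≠ 0 := by
      intro x hx
      rcases eq_or_lt_of_le hx.1 with h | h
      · rw [← h]; exact hv₂
      rcases eq_or_lt_of_le hx.2 with h' | h'
      · rw [h']; exact hvXpos.ne'
      exact hcon x ⟨h, h'⟩
    have hlt := hf.picone₂_lt hχ (v := fun t ↦ hermiteH4 (κ * t))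
      (v' := fun t ↦ κ * hermiteH4' (κ * t))
      (qv := fun t ↦ κ ^ 2 * (4 * π ^ 2 * (κ * t) ^ 2 - 18 * π)) (c := lam ^ 2 - X ^ 2)
      (a := ζ₂) (b := X) hv hv' hc0 (by linarith) (by linarith) (by linarith) le_rfl hvne'
      (fun x hx ↦ hfne x ⟨by linarith [hx.1], by linarith [hx.2]⟩
        (show ζ₁ < x by linarith [hx.1]).ne' hx.1.ne')
      (fun x _ ↦ hgap x)
    have hlt' : 0 < f X * ((lam ^ 2 - X ^ 2) * deriv f X)
        - (lam ^ 2 - X ^ 2) * f X ^ 2 * (κ * hermiteH4' (κ * X)) / hermiteH4 (κ * X) := by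
      simpa [hz₂] using hlt
    have hfX : f X ≠ 0 :=
      hfne X ⟨hX0, by linarith⟩ (show ζ₁ < X by linarith).ne' (show ζ₂ < X by linarith).ne'
    have hlog : -(2 * π * (κ * X)) * hermiteH4 (κ * X) ^ 2
        ≤ hermiteH4' (κ * X) * hermiteH4 (κ * X) := hermiteH4'_mul_ge hκX
    have hsg := lower_sign_aux (B := hermiteH4' (κ * X)) hvXpos hX0 hκ0 hc0
      (by linarith [sq_nonneg X]) hθκ hl2 hW hlog
    have eΦ : f X * ((lam ^ 2 - X ^ 2) * deriv f X)
        - (lam ^ 2 - X ^ 2) * f X ^ 2 * (κ * hermiteH4' (κ * X)) / hermiteH4 (κ * X)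
        = -(f X ^ 2 * (-((lam ^ 2 - X ^ 2) * deriv f X) / f X
          + (lam ^ 2 - X ^ 2) * κ * hermiteH4' (κ * X) / hermiteH4 (κ * X))) := by
      field_simp; ring
    rw [eΦ] at hlt'
    have : 0 < f X ^ 2 * (-((lam ^ 2 - X ^ 2) * deriv f X) / f X
        + (lam ^ 2 - X ^ 2) * κ * hermiteH4' (κ * X) / hermiteH4 (κ * X)) :=
      mul_pos (by positivity) hsg
    linarith
  obtain ⟨r₃, hr₃, hvr₃⟩ := h3
  exact hermiteH4_three_zeros hκ0 hr₁.1 (by linarith [hr₂.1]) (by linarith [hr₃.1])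
    (by linarith [hr₁.2, hr₂.1] : r₁ ≠ r₂) (by linarith [hr₁.2, hr₃.1, hr₂.1] : r₁ ≠ r₃)
    (by linarith [hr₂.2, hr₃.1] : r₂ ≠ r₃) hvr₁ hvr₂ hvr₃

set_option maxHeartbeats 800000 in
/-- **Lower pinning, `n = 0`**: `(2π − δ)λ² ≤ χ₀(λ)` for `λ ≥ Λ(δ)`. [cite: SlepianPollak1961,
§III; folklore proof by Sturm–Picone comparison] -/
theorem eigen_lower_zero {δ : ℝ} (hδ : 0 < δ) : ∃ Λ : ℝ, ∀ lam : ℝ, Λ ≤ lam →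
    ∀ f : ℝ → ℝ, ∀ χ : ℝ, IsProlateFunction lam 0 f →
    (∀ x ∈ Ioo (-lam) lam,
      -(deriv (fun y ↦ (lam ^ 2 - y ^ 2) * deriv f y) x) + (2 * π * lam * x) ^ 2 * f x = χ * f x) →
    (2 * π - δ) * lam ^ 2 ≤ χ := by
  have hπ := Real.pi_gt_three
  have hπ' := Real.pi_lt_d2
  have hπ0 := Real.pi_pos
  set μ : ℝ := 2 * π with hμ
  have hμ0 : 0 < μ := by positivity
  set ε : ℝ := min δ μ / (16 * μ) with hε
  have hm0 : 0 < min δ μ := lt_min hδ hμ0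
  have hε0 : 0 < ε := by rw [hε]; positivity
  have hε16 : 16 * ε ≤ 1 := by
    have : 16 * ε = min δ μ / μ := by rw [hε]; field_simp
    rw [this, div_le_one hμ0]; exact min_le_right δ μ
  have hεδ : 16 * ε * μ ≤ δ := by
    have : 16 * ε * μ = min δ μ := by rw [hε]; field_simp
    rw [this]; exact min_le_left δ μ
  set θ : ℝ := 1 - ε / 2 with hθ
  have hθ0 : 0 < θ := by rw [hθ]; linarith
  have hθ1 : θ ≤ 1 := by rw [hθ]; linarith
  set X : ℝ := (2 * π + μ) / (2 * π ^ 2 * ε) + 2 with hX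
  have hX2 : 2 ≤ X := by rw [hX]; linarith [(by positivity : 0 ≤ (2 * π + μ) / (2 * π ^ 2 * ε))]
  have hX0 : 0 < X := by linarith
  have hXε : 2 * π + μ ≤ 2 * π ^ 2 * ε * X := by
    have : 2 * π ^ 2 * ε * X = (2 * π + μ) + 4 * π ^ 2 * ε := by rw [hX]; field_simp; ring
    rw [this]; linarith [(by positivity : 0 ≤ 4 * π ^ 2 * ε)]
  refine ⟨2 * (X + 1) / ε + X * (1 + 4 * μ / (3 * δ)) + 2, fun lam hlam f χ hf hχ ↦ ?_⟩
  by_contra H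
  have H' : χ < (μ - δ) * lam ^ 2 := not_le.1 H
  have hlam0 := hf.lam_pos
  have hl2 : 0 < lam ^ 2 := by positivity
  have hbig' : 0 ≤ X * (1 + 4 * μ / (3 * δ)) := by positivity
  have hΛ1 : 2 * (X + 1) / ε ≤ lam := by linarith
  have hΛ2 : X * (1 + 4 * μ / (3 * δ)) ≤ lam := by
    linarith [(by positivity : 0 ≤ 2 * (X + 1) / ε)]
  have hXl : X + 1 < lam := by
    have : X + 1 ≤ 2 * (X + 1) / ε := by
      rw [le_div_iff₀ hε0]; nlinarith
    linarith
  have hχμ : χ < μ * lam ^ 2 := by have := mul_pos hδ hl2; linarith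
  have hχX : χ ≤ (2 * π * lam * X) ^ 2 := by
    have h0 : 12 ≤ 2 * π * X := by
      have := mul_le_mul hπ.le hX2 (by norm_num) hπ0.le; linarith
    have h1 : (144 : ℝ) ≤ (2 * π * X) ^ 2 := by
      have := pow_le_pow_left₀ (by norm_num) h0 2; linarith
    have e : (2 * π * lam * X) ^ 2 = (2 * π * X) ^ 2 * lam ^ 2 := by ring
    have h2 := mul_le_mul_of_nonneg_right h1 hl2.le
    have h3 : μ * lam ^ 2 ≤ 144 * lam ^ 2 := mul_le_mul_of_nonneg_right (by rw [hμ]; linarith) hl2.le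
    rw [e]
    linarith
  -- hypotheses of `riccati_lower`
  have hlamp : θ * lam ^ 2 ≤ lam ^ 2 - (X + 1) ^ 2 := by
    have h1 : 2 * (X + 1) ≤ ε * lam := by
      have := hΛ1; rw [div_le_iff₀ hε0] at this; linarith
    have h2 : 2 * (X + 1) * lam ≤ ε * lam * lam := mul_le_mul_of_nonneg_right h1 hlam0.le
    have h3 : (X + 1) ^ 2 ≤ (X + 1) * lam := by
      rw [sq]; exact mul_le_mul_of_nonneg_left hXl.le (by linarith)
    rw [hθ]; linarith
  have hm : 2 * π * θ * X ≤ 4 * π ^ 2 * X ^ 2 * (1 - θ ^ 2 / θ) - χ / lam ^ 2 := by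
    have e1 : θ ^ 2 / θ = θ := by rw [sq, mul_div_assoc, div_self hθ0.ne', mul_one]
    have h1 : χ / lam ^ 2 < μ := (div_lt_iff₀ hl2).2 (by linarith)
    have h2 : 2 * π * θ * X ≤ 2 * π * 1 * X :=
      mul_le_mul_of_nonneg_right (mul_le_mul_of_nonneg_left hθ1 (by positivity)) hX0.le
    have h3 : (2 * π + μ) * X ≤ 2 * π ^ 2 * ε * X * X := mul_le_mul_of_nonneg_right hXε hX0.le
    have h4 : μ ≤ μ * X := le_mul_of_one_le_right hμ0.le (by linarith)
    have h5 : 4 * π ^ 2 * X ^ 2 * (1 - θ) = 2 * π ^ 2 * ε * X * X := by rw [hθ]; ring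
    rw [e1]
    linarith
  have hW := hf.riccati_lower hχ (X := X) (θ := θ) (p₀ := θ) hX0.le hθ0 hθ0 hlamp hχX hm
  -- `κ ∈ (1 − 2ε, 1 − ε)`
  obtain ⟨κ, hκ, -⟩ := exists_generic_mul Set.finite_empty (∅ : Finset ℝ)
    (show 1 - 2 * ε < 1 - ε by linarith)
  have hκ0 : 0 < κ := by linarith [hκ.1]
  have hκ1 : κ ^ 2 ≤ 1 := pow_le_one₀ hκ0.le (by linarith [hκ.2])
  have hκsq : 1 - 4 * ε ≤ κ ^ 2 := by
    have := pow_le_pow_left₀ (by linarith : 0 ≤ 1 - 2 * ε) hκ.1.le 2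
    linarith [sq_nonneg ε]
  have hθκ : κ ^ 2 < θ := by
    have h1 := pow_lt_pow_left₀ hκ.2 hκ0.le two_ne_zero
    have h2 : ε * ε ≤ ε * (1 / 16) := mul_le_mul_of_nonneg_left (by linarith) hε0.le
    rw [hθ]; linarith
  -- the gap on `(0, X)`
  have hbig : X ^ 2 * μ < 3 * δ / 4 * lam ^ 2 := by
    have h1 : X ^ 2 * (1 + 4 * μ / (3 * δ)) ^ 2 ≤ lam ^ 2 := by
      rw [← mul_pow]; exact pow_le_pow_left₀ hbig' hΛ2 2
    have h2 : X ^ 2 * μ < 3 * δ / 4 * (X ^ 2 * (1 + 4 * μ / (3 * δ)) ^ 2) := by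
      have e : 3 * δ / 4 * (X ^ 2 * (1 + 4 * μ / (3 * δ)) ^ 2)
          = X ^ 2 * μ + X ^ 2 * (3 * δ / 4 + μ + 4 * μ ^ 2 / (3 * δ)) := by
        field_simp; ring
      rw [e]
      have : 0 < X ^ 2 * (3 * δ / 4 + μ + 4 * μ ^ 2 / (3 * δ)) := by positivity
      linarith
    have h3 := mul_le_mul_of_nonneg_left h1 (by positivity : 0 ≤ 3 * δ / 4)
    linarith
  have hX2l : X ^ 2 ≤ lam ^ 2 := pow_le_pow_left₀ hX0.le (by linarith) 2
  have hgap : ∀ x : ℝ, (lam ^ 2 - X ^ 2) * (κ ^ 2 * (4 * π ^ 2 * (κ * x) ^ 2 - 2 * π))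
      < (2 * π * lam * x) ^ 2 - χ :=
    fun x ↦ lower_gap_aux hμ0.le hε0.le hκ1 hκsq hεδ (sq_nonneg X) hX2l hbig H'
  have hc0 : 0 ≤ lam ^ 2 - X ^ 2 := sub_nonneg.2 hX2l
  have hv := hasDerivAt_hermiteH0_comp κ
  have hv' := hasDerivAt_hermiteH0'_comp κ
  have hlt := hf.picone₂_lt hχ (v := fun t ↦ hermiteH0 (κ * t))
    (v' := fun t ↦ κ * hermiteH0' (κ * t))
    (qv := fun t ↦ κ ^ 2 * (4 * π ^ 2 * (κ * t) ^ 2 - 2 * π)) (c := lam ^ 2 - X ^ 2)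
    (a := 0) (b := X) hv hv' hc0 le_rfl hX0 (by linarith) le_rfl
    (fun x _ ↦ (hermiteH0_pos _).ne')
    (fun x hx ↦ (hf.pos_of_zero ⟨by linarith [hx.1], by linarith [hx.2]⟩).ne')
    (fun x _ ↦ hgap x)
  have hlt' : 0 < f X * ((lam ^ 2 - X ^ 2) * deriv f X)
      - (lam ^ 2 - X ^ 2) * f X ^ 2 * (κ * hermiteH0' (κ * X)) / hermiteH0 (κ * X) := by
    simpa [hf.deriv_zero, hermiteH0'_zero] using hlt
  have hfX : f X ≠ 0 := (hf.pos_of_zero ⟨by linarith, by linarith⟩).ne'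
  have hApos : 0 < hermiteH0 (κ * X) := hermiteH0_pos _
  have hlog : -(2 * π * (κ * X)) * hermiteH0 (κ * X) ^ 2
      ≤ hermiteH0' (κ * X) * hermiteH0 (κ * X) := le_of_eq (by rw [hermiteH0'_eq]; ring)
  have hsg := lower_sign_aux (B := hermiteH0' (κ * X)) hApos hX0 hκ0 hc0
    (by linarith [sq_nonneg X]) hθκ hl2 hW hlog
  have eΦ : f X * ((lam ^ 2 - X ^ 2) * deriv f X)
      - (lam ^ 2 - X ^ 2) * f X ^ 2 * (κ * hermiteH0' (κ * X)) / hermiteH0 (κ * X)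
      = -(f X ^ 2 * (-((lam ^ 2 - X ^ 2) * deriv f X) / f X
        + (lam ^ 2 - X ^ 2) * κ * hermiteH0' (κ * X) / hermiteH0 (κ * X))) := by
    field_simp; ring
  rw [eΦ] at hlt'
  have : 0 < f X ^ 2 * (-((lam ^ 2 - X ^ 2) * deriv f X) / f X
      + (lam ^ 2 - X ^ 2) * κ * hermiteH0' (κ * X) / hermiteH0 (κ * X)) :=
    mul_pos (by positivity) hsg
  linarith

/-! ### The limits `χ_n(λ)/λ² → 2π(2n+1)` (`n = 0, 4`) -/

/-- **Eigenvalue asymptotics, `n = 0`**: `χ₀(λ)/λ² → 2π`, uniformly over all prolate data.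
[cite: SlepianPollak1961, §III (`χ_n(c) ∼ (2n+1)c`); proof here by Sturm–Picone comparison] -/
theorem eigen_tendsto_of_zero {δ : ℝ} (hδ : 0 < δ) : ∃ Λ : ℝ, ∀ lam : ℝ, Λ ≤ lam →
    ∀ f : ℝ → ℝ, ∀ χ : ℝ, IsProlateFunction lam 0 f →
    (∀ x ∈ Ioo (-lam) lam,
      -(deriv (fun y ↦ (lam ^ 2 - y ^ 2) * deriv f y) x) + (2 * π * lam * x) ^ 2 * f x = χ * f x) →
    |χ / lam ^ 2 - 2 * π| ≤ δ := by
  obtain ⟨Λ₁, h₁⟩ := eigen_upper_zero hδ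
  obtain ⟨Λ₂, h₂⟩ := eigen_lower_zero hδ
  refine ⟨max Λ₁ Λ₂, fun lam hlam f χ hf hχ ↦ ?_⟩
  have hl2 : 0 < lam ^ 2 := pow_pos hf.lam_pos 2
  have hu := h₁ lam ((le_max_left _ _).trans hlam) f χ hf hχ
  have hl := h₂ lam ((le_max_right _ _).trans hlam) f χ hf hχ
  rw [abs_le]
  constructor
  · rw [le_sub_iff_add_le, le_div_iff₀ hl2]; linarith
  · rw [sub_le_iff_le_add, div_le_iff₀ hl2]; linarith

/-- **Eigenvalue asymptotics, `n = 4`**: `χ₄(λ)/λ² → 18π`, uniformly over all prolate data.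
[cite: SlepianPollak1961, §III (`χ_n(c) ∼ (2n+1)c`); proof here by Sturm–Picone comparison] -/
theorem eigen_tendsto_of_four {δ : ℝ} (hδ : 0 < δ) : ∃ Λ : ℝ, ∀ lam : ℝ, Λ ≤ lam →
    ∀ f : ℝ → ℝ, ∀ χ : ℝ, IsProlateFunction lam 4 f →
    (∀ x ∈ Ioo (-lam) lam,
      -(deriv (fun y ↦ (lam ^ 2 - y ^ 2) * deriv f y) x) + (2 * π * lam * x) ^ 2 * f x = χ * f x) →
    |χ / lam ^ 2 - 18 * π| ≤ δ := by
  obtain ⟨Λ₁, h₁⟩ := eigen_upper_four hδ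
  obtain ⟨Λ₂, h₂⟩ := eigen_lower_four hδ
  refine ⟨max Λ₁ Λ₂, fun lam hlam f χ hf hχ ↦ ?_⟩
  have hl2 : 0 < lam ^ 2 := pow_pos hf.lam_pos 2
  have hu := h₁ lam ((le_max_left _ _).trans hlam) f χ hf hχ
  have hl := h₂ lam ((le_max_right _ _).trans hlam) f χ hf hχ
  rw [abs_le]
  constructor
  · rw [le_sub_iff_add_le, le_div_iff₀ hl2]; linarith
  · rw [sub_le_iff_le_add, div_le_iff₀ hl2]; linarith

end IsProlateFunction

end Literature.NumberTheory.LFunctions
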